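import Mathlib
import HarnessLib

/-!
# The Dobrushin–Pechersky colour-class sweep: from the one-step estimates (21)–(24) to the
# two-parameter bound of Lemma 3.7 (Conache–Kondratiev–Kozitsky–Pasurek 2015, §4)

[topic Probability/TransportMaps]

D. Conache, Yu. Kondratiev, Yu. Kozitsky, T. Pasurek, *Gibbs Fields: Uniqueness and Decay of
Correlations. Revisiting Dobrushin and Pechersky*, arXiv:1501.00673 (2015) [ConacheEtAl2015] —
the refined proof of the Dobrushin–Pechersky uniqueness-and-decay criterion for Gibbs fields with
non-compact spins [DobrushinPechersky1983]. Its engine (§3.3 and §4, verbatim up to notation):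
a graph with `sup_ℓ Δ_ℓ = Δ` (1), «we assume `Δ ≥ 2`», independent classes
`L = ⋃_{j=0}^{χ−1} V_j` (3); the resampling maps `R_ℓ` (16) acting on couplings `ν`; the functionals
`ν(I_ℓ)`, `ν(I_ℓ H^i_{ℓ'})` (19)–(20) with `γ(ν) = sup_ℓ ν(I_ℓ)` (18) and
`λ(ν) = max_i sup_{ℓ,ℓ'} ν(I_ℓ H^i_{ℓ'})` (26); Lemma 3.4 (b) (`R_ℓ` does not move functionals not
reading `ℓ`); the one-step estimates of Lemma 3.6,
(21) `(R_ℓ ν)(I_ℓ) ≤ Σ_{ℓ'∈∂ℓ} κ_{ℓℓ'} ν(I_{ℓ'}) + K⁻¹ Σ_{i=1,2} Σ_{ℓ₁,ℓ₂∈∂ℓ} ν(I_{ℓ₂}H^i_{ℓ₁})`,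
(22) `(R_ℓ ν)(I_{ℓ₁}H^i_ℓ) ≤ ν(I_{ℓ₁}) + Σ_{ℓ₂∈∂ℓ} c_{ℓℓ₂} ν(I_{ℓ₁}H^i_{ℓ₂})`,
(23) `(R_ℓ ν)(I_ℓ H^i_{ℓ₁}) ≤ Σ_{ℓ₂∈∂ℓ} ν(I_{ℓ₂}H^i_{ℓ₁})`, `ℓ₁ ≠ ℓ`,
(24) `(R_ℓ ν)(I_ℓ H^i_ℓ) ≤ Σ_{ℓ₁∈∂ℓ} ν(I_{ℓ₁}) + Σ_{ℓ₁,ℓ₂∈∂ℓ} c_{ℓℓ₂} ν(I_{ℓ₁}H^i_{ℓ₂})`;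
the constants (9) `κ̄ < 1`, (13) `c̄ < 1/Δ^χ`, (26a) `A = 2Δ^{χ+1}/(1 − κ̄)`,
(26b) `K⁻¹ < c̄(1 − κ̄)/(4Δ^{χ+1})`, `AK⁻¹ < c̄/2`; and

**Lemma 3.7.** «For `K > K_*`, take `π ∈ Π(h,K,κ,c)` and `μ₁, μ₂ ∈ 𝓜(π,h)`. Then for each
`ν₀ ∈ 𝒞(μ₁, μ₂)` there exists `ν ∈ 𝒞(μ₁, μ₂)` for which the following estimates hold
(27) `γ(ν) ≤ [κ̄ + AK⁻¹] γ(ν₀) + 2AK⁻¹ λ(ν₀)`, (28) `λ(ν) ≤ Δ^{χ−1} γ(ν₀) + c̄ Δ^χ λ(ν₀)`.»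
Its proof (§4): `ν` is obtained by sweeping `R_ℓ` over `V₀` (§4.1, (30)–(40)), then `V₁, …`, with the
induction table (41)–(42) — «`ν_j(I_ℓ) ≤ [κ̄ + AK⁻¹]γ(ν₀) + 2AK⁻¹λ(ν₀)` for `ℓ ∈ U_{j−1}`, `γ(ν₀)`
for `ℓ ∈ W_{j−1}`; `ν_j(I_ℓ H^i_{ℓ'}) ≤ Δ^j γ(ν₀) + c̄Δ^{j+1} λ(ν₀)` (`ℓ, ℓ' ∈ U_{j−1}`), `Δ^j λ(ν₀)`
(`ℓ ∈ U_{j−1}, ℓ' ∈ W_{j−1}`), `j γ(ν₀) + c̄ λ(ν₀)` (`ℓ ∈ W_{j−1}, ℓ' ∈ V_{j−1}`), `λ(ν₀)`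
(`ℓ, ℓ' ∈ W_{j−1}`)» — propagated class by class through (45), (48a), (49), (50)–(51b),
(52)–(53b), (54), using only Lemma 3.4 (b), (21)–(24), `Δ ≥ 2`, `j ≤ Δ^j`, (13) and (26b).

THIS FILE formalises that sweep ABSTRACTLY, so that it applies to any realisation of the one-step
estimates (the tree's realisation for one-site TV couplings is
`Literature/Probability/TransportMaps/DobrushinPecherskyStep.lean`, staged in the pub-ymgap cell):
* `DPSystem` — the data (`∂`, `κ`, `c`, `ε = K⁻¹`, the maps `R_ℓ` on an arbitrary state type, the
  two families of functionals; the marginal index `i = 1, 2` is an arbitrary `Fintype A`);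
  `IsDPStep` — Lemma 3.4 (b) (as `≤`) and (21)–(24) as hypotheses;
* `sweepList` / `ClassBounds` / `IsDPStep.classBounds` — the structural content of §4.1–4.2: along an
  independent list of sites the maps `R_ℓ` do not interact, so after the class every functional is
  bounded by (21)–(24) evaluated at PRE-class values ((31)–(38), (45), (49), (50), (52), (54));
* `Admissible` — the constants: `Δ ≥ 2`, `#∂ℓ ≤ Δ`, row sums `≤ κ̄ ≤ 1`, `≤ c̄` with `c̄Δ^χ ≤ 1`,
  `2α ≤ c̄` and `(#A)Δ^{χ+1}ε + ακ̄ ≤ α`, where `α` is the printed `AK⁻¹` and `ε` the printed `K⁻¹`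
  (with `#A = 2` the last line is `2Δ^{χ+1}K⁻¹ ≤ A(1 − κ̄)K⁻¹`, i.e. the definition (26a) of `A`;
  strict inequalities of print are used non-strictly);
* `Table` — the table (41)–(42) at level `j` for a processed set `U`; `table_base` (§4.1: level `0 → 1`)
  and `table_step` (§4.2: level `j → j+1`, `1 ≤ j ≤ χ − 1`);
* `sweep`, `table_sweepUpTo`, ★ `lemma_3_7` — after the sweep over a proper `χ`-colouring:
  (27) verbatim and (28′) `λ(ν) ≤ Δ^χ γ(ν₀) + c̄Δ^{χ+1} λ(ν₀)`; `sweep_induction` carries any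
  `R_ℓ`-invariant property (Lemma 3.4 (a): being a coupling of `μ₁, μ₂`) to `ν`;
  `iterate_recursion` — (28a): the two-term recursion for repeated sweeps, the input of the
  `2 × 2` contraction (`…/DobrushinPecherskyContraction.lean`).

READING NOTE (honest; pub-ymgap records `HOME/ym3ir/AS-PRINTED.md` §11/§13, erratum candidate
E-DP-1). The table (42) is at level `j` after `j` classes (it is (40) for `j = 1`), so after all `χ`
classes the exponents are `(Δ^χ, c̄Δ^{χ+1})`, not the `(Δ^{χ−1}, c̄Δ^χ)` of (28) (print evaluates the
table at «`j = Δ − 1`»); (srM)'s discriminant term `8Δ^χ AK⁻¹` matches `Δ^χ`, while `K_*` in (K) and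
`ξ` in (dc11) match (28) as printed. From the hypotheses used by the printed proof — Lemma 3.4 (b),
(21)–(24), (9), (13), (26) — (28) cannot be recovered: on the 4-cycle (`Δ = 2`, `χ = 2`) with
`κ = c = 0`, `K⁻¹ = 0`, initial values `ν₀(I_ℓ) = 1`, `ν₀(I_ℓ H_{ℓ'}) = 0` and each `R_ℓ` realising
(21)–(24) with equality, the sweep `V₀ = {0, 2}`, `V₁ = {1, 3}` ends with `ν(I₁ H₀) = 4 = Δ^χ γ(ν₀)`,
above (28)'s `Δ^{χ−1} γ(ν₀) + c̄Δ^χ λ(ν₀) = 2` and equal to (28′). Consequently the contraction step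
of Theorem 2.6 needs `c̄ Δ^{χ+1} < 1` and the threshold `K_*` with `χ` replaced by `χ + 1` in its
second entry; the statements of Theorems 2.6/2.7 are otherwise unaffected (their hypotheses only
become `c̄ < Δ^{−(χ+1)}`, `K > K_*'`). We prove exactly what the printed argument yields and flag the
difference; nothing here is stated more strongly than its source supports.

Scope (honest): finitely many sites swept (each class a finite list; the state type is arbitrary, so
infinite graphs enter only through finite sweeps — the `𝔏`-limit of §4.1 is not needed for finite
classes and is not formalised); no measures, kernels or specifications appear — those are supplied by
an instance of `IsDPStep`. Nothing about lattice gauge theory, continuum limits or mass gaps.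
No named facts (D-0026): every statement is proved.

## References
* [ConacheEtAl2015] D. Conache, Yu. Kondratiev, Yu. Kozitsky, T. Pasurek, arXiv:1501.00673, §2.1
  (1)–(3), §2.2 (9)–(13), §3.2 Lemma 3.6 (21)–(24), (26), §3.3 (26a)–(26b), Lemma 3.7 (27)–(28),
  (28a), §4 (29)–(54). Quoted from the held TeX, `paper:arxiv-1501.00673` pp. 4–16.
* [DobrushinPechersky1983] R. L. Dobrushin, E. A. Pechersky, *A criterion of the uniqueness of
  Gibbsian fields in the non-compact case*, LNM 1021 (1983) 97–110 (the original; §4 of the above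
  is its Lemma 3 made explicit).
-/

noncomputable section

open Finset

open scoped ENNReal NNReal

namespace Literature.Probability.TransportMaps

namespace DobrushinPecherskySweep

variable {ι : Type*} {St : Type*} {A : Type*}

/-- The data of an abstract Dobrushin–Pechersky resampling scheme on a site set `ι`, a state space
`St` (in print: couplings `ν ∈ 𝒞(μ₁, μ₂)`), with marginal index `A` (in print `i = 1, 2`):
out-neighbourhoods `∂ℓ = nbr ℓ`, the matrices `κ`, `c` of (9)–(13) (one Lyapunov matrix per
marginal), the constant `ε` in front of the mixed moments in (21) (in print `K⁻¹`), the one-site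
maps `R_ℓ` of (16), and the functionals `ν(I_ℓ)` (`γf ν ℓ`) and `ν(I_ℓ H^i_{ℓ'})` (`Λ ν i ℓ ℓ'`) of
(19)–(20). [cite: ConacheEtAl2015, §3.1–3.2 (16), (19)–(20)] -/
structure DPSystem (ι St A : Type*) where
  /-- `∂ℓ`: the sites the one-site kernel at `ℓ` reads. -/
  nbr : ι → Finset ι
  /-- the Dobrushin matrix of (9)–(10). -/
  κ : ι → ι → ℝ≥0∞
  /-- the Lyapunov matrices of (12)–(13), one per marginal. -/
  c : A → ι → ι → ℝ≥0∞
  /-- the constant in front of the mixed moments in (21) (`K⁻¹` in print). -/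
  ε : ℝ≥0
  /-- the one-site reconstruction maps `R_ℓ` of (16). -/
  R : ι → St → St
  /-- `ν ↦ ν(I_ℓ)`. -/
  γf : St → ι → ℝ≥0∞
  /-- `ν ↦ ν(I_ℓ H^i_{ℓ'})`. -/
  Λ : St → A → ι → ι → ℝ≥0∞

variable (S : DPSystem ι St A)

namespace DPSystem

/-- Sequential reconstruction along a list of sites: `R_{ℓₙ} ⋯ R_{ℓ₁} ν` for `L = [ℓ₁, …, ℓₙ]`
(print, (30): `ν^{(n)} = R_{ℓₙ} R_{ℓₙ₋₁} ⋯ R_{ℓ₁} ν`). [cite: ConacheEtAl2015, §4.1 (30)] -/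
def sweepList (L : List ι) (ν : St) : St := L.foldl (fun ν ℓ => S.R ℓ ν) ν

/-- Empty sweep. [cite: ConacheEtAl2015, §4.1 (30)] -/
@[simp] theorem sweepList_nil (ν : St) : S.sweepList [] ν = ν := rfl

/-- `R_{ℓₙ} ⋯ R_{ℓ₂} (R_{ℓ₁} ν)`. [cite: ConacheEtAl2015, §4.1 (30)] -/
@[simp] theorem sweepList_cons (ℓ : ι) (L : List ι) (ν : St) :
    S.sweepList (ℓ :: L) ν = S.sweepList L (S.R ℓ ν) := rfl

/-- Sweeping a concatenation = sweeping in turn. [cite: ConacheEtAl2015, §4.1 (30)] -/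
theorem sweepList_append (L L' : List ι) (ν : St) :
    S.sweepList (L ++ L') ν = S.sweepList L' (S.sweepList L ν) := by
  simp [sweepList, List.foldl_append]

/-- Any property preserved by every `R_ℓ` (in print: being a coupling of `μ₁, μ₂`, Lemma 3.4 (a))
is preserved along a sweep. [cite: ConacheEtAl2015, Lemma 3.4 (a)] -/
theorem sweepList_induction (P : St → Prop) (hP : ∀ ℓ ν, P ν → P (S.R ℓ ν)) :
    ∀ (L : List ι) (ν : St), P ν → P (S.sweepList L ν) := by
  intro L
  induction L with
  | nil => intro ν h; simpa
  | cons ℓ L ih => intro ν h; exact ih _ (hP ℓ ν h)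

/-! ### The bounds produced by one class sweep, in terms of the PRE-sweep state -/

/-- RHS of (22) at `ν` (bound for `(R_ℓ ν)(I_{ℓ₁}H^i_ℓ)`). [cite: ConacheEtAl2015, Lemma 3.6 (22)] -/
def b22 (ν : St) (a : A) (ℓ₁ ℓ : ι) : ℝ≥0∞ :=
  S.γf ν ℓ₁ + ∑ ℓ₂ ∈ S.nbr ℓ, S.c a ℓ ℓ₂ * S.Λ ν a ℓ₁ ℓ₂

/-- RHS of (23) at `ν` (bound for `(R_ℓ ν)(I_ℓ H^i_{ℓ₁})`). [cite: ConacheEtAl2015, Lemma 3.6 (23)] -/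
def b23 (ν : St) (a : A) (ℓ ℓ₁ : ι) : ℝ≥0∞ := ∑ ℓ₂ ∈ S.nbr ℓ, S.Λ ν a ℓ₂ ℓ₁

/-- RHS of (24) at `ν`. [cite: ConacheEtAl2015, Lemma 3.6 (24)] -/
def b24 (ν : St) (a : A) (ℓ : ι) : ℝ≥0∞ :=
  (∑ ℓ₁ ∈ S.nbr ℓ, S.γf ν ℓ₁) + ∑ ℓ₁ ∈ S.nbr ℓ, ∑ ℓ₂ ∈ S.nbr ℓ, S.c a ℓ ℓ₂ * S.Λ ν a ℓ₁ ℓ₂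

/-- RHS of (54): `ℓ'` reconstructed BEFORE `ℓ`, bound for `ν'(I_ℓ H^i_{ℓ'})`. [cite: ConacheEtAl2015, §4.2 (54)] -/
def b54 (ν : St) (a : A) (ℓ ℓ' : ι) : ℝ≥0∞ := ∑ ℓ₁ ∈ S.nbr ℓ, S.b22 ν a ℓ₁ ℓ'

/-- Domination of `ν₁` by `ν` on the functionals supported in a set of sites `T` (the form in which
Lemma 3.4 (b) is used: «`ν₀^{(n)}(I_ℓ) = ν₀(I_ℓ)` for `ℓ ∉ V₀^{(n)}`», (31)). [cite: ConacheEtAl2015, Lemma 3.4 (b), §4.1 (31)] -/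
def DomOn (T : Set ι) (ν₁ ν : St) : Prop :=
  (∀ x ∈ T, S.γf ν₁ x ≤ S.γf ν x) ∧ ∀ a, ∀ x ∈ T, ∀ y ∈ T, S.Λ ν₁ a x y ≤ S.Λ ν a x y

variable {S}

section mono

variable {T : Set ι} {ν₁ ν : St} (hd : S.DomOn T ν₁ ν)
include hd

/-- (22)'s RHS is monotone in the pre-state off the resampled site. [cite: ConacheEtAl2015, Lemma 3.4 (b), §4.1 (31)] -/
theorem b22_mono {a : A} {ℓ₁ ℓ : ι} (h₁ : ℓ₁ ∈ T) (hℓ : ∀ x ∈ S.nbr ℓ, x ∈ T) :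
    S.b22 ν₁ a ℓ₁ ℓ ≤ S.b22 ν a ℓ₁ ℓ := by
  unfold b22
  gcongr with x hx
  · exact hd.1 _ h₁
  · exact hd.2 a _ h₁ _ (hℓ x hx)

/-- (23)'s RHS is monotone in the pre-state off the resampled site. [cite: ConacheEtAl2015, Lemma 3.4 (b), §4.1 (31)] -/
theorem b23_mono {a : A} {ℓ ℓ₁ : ι} (h₁ : ℓ₁ ∈ T) (hℓ : ∀ x ∈ S.nbr ℓ, x ∈ T) :
    S.b23 ν₁ a ℓ ℓ₁ ≤ S.b23 ν a ℓ ℓ₁ := by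
  unfold b23
  gcongr with x hx
  exact hd.2 a _ (hℓ x hx) _ h₁

/-- (24)'s RHS is monotone in the pre-state off the resampled site. [cite: ConacheEtAl2015, Lemma 3.4 (b), §4.1 (31)] -/
theorem b24_mono {a : A} {ℓ : ι} (hℓ : ∀ x ∈ S.nbr ℓ, x ∈ T) : S.b24 ν₁ a ℓ ≤ S.b24 ν a ℓ := by
  unfold b24
  gcongr with x hx x hx y hy
  · exact hd.1 x (hℓ x hx)
  · exact hd.2 a _ (hℓ x hx) _ (hℓ y hy)

/-- (54)'s RHS is monotone in the pre-state off the resampled sites. [cite: ConacheEtAl2015, Lemma 3.4 (b), §4.2 (54)] -/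
theorem b54_mono {a : A} {ℓ ℓ' : ι} (hℓ : ∀ x ∈ S.nbr ℓ, x ∈ T) (hℓ' : ∀ x ∈ S.nbr ℓ', x ∈ T) :
    S.b54 ν₁ a ℓ ℓ' ≤ S.b54 ν a ℓ ℓ' := by
  unfold b54
  gcongr with x hx
  exact b22_mono hd (hℓ x hx) hℓ'

end mono

variable [Fintype A]

variable (S)

/-- **Lemma 3.4 (b) + Lemma 3.6 as hypotheses.** `R_ℓ` does not increase functionals that do not
read the site `ℓ` («`(R_ℓ ν)(I_{ℓ₁}) = ν(I_{ℓ₁})`, `(R_ℓ ν)(I_{ℓ₁}H^i_{ℓ₂}) = ν(I_{ℓ₁}H^i_{ℓ₂})` for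
`ℓ ≠ ℓ₁, ℓ ≠ ℓ₂`», used here only as `≤`), and the four one-step estimates (verbatim):
(21) `(R_ℓ ν)(I_ℓ) ≤ Σ_{ℓ'∈∂ℓ} κ_{ℓℓ'} ν(I_{ℓ'}) + K⁻¹ Σ_{i} Σ_{ℓ₁,ℓ₂∈∂ℓ} ν(I_{ℓ₂}H^i_{ℓ₁})`,
(22) `(R_ℓ ν)(I_{ℓ₁}H^i_ℓ) ≤ ν(I_{ℓ₁}) + Σ_{ℓ₂∈∂ℓ} c_{ℓℓ₂} ν(I_{ℓ₁}H^i_{ℓ₂})` (`ℓ₁ ≠ ℓ`),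
(23) `(R_ℓ ν)(I_ℓ H^i_{ℓ₁}) ≤ Σ_{ℓ₂∈∂ℓ} ν(I_{ℓ₂}H^i_{ℓ₁})`, `ℓ₁ ≠ ℓ`,
(24) `(R_ℓ ν)(I_ℓ H^i_ℓ) ≤ Σ_{ℓ₁∈∂ℓ} ν(I_{ℓ₁}) + Σ_{ℓ₁,ℓ₂∈∂ℓ} c_{ℓℓ₂} ν(I_{ℓ₁}H^i_{ℓ₂})`.
[cite: ConacheEtAl2015, Lemma 3.4 (b), Lemma 3.6 (21)–(24)] -/
structure IsDPStep : Prop where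
  /-- Lemma 3.4 (b) for `I_{ℓ'}`, `ℓ' ≠ ℓ`. -/
  γ_of_ne : ∀ ν ℓ ℓ', ℓ' ≠ ℓ → S.γf (S.R ℓ ν) ℓ' ≤ S.γf ν ℓ'
  /-- Lemma 3.4 (b) for `I_{ℓ₁}H^i_{ℓ₂}`, `ℓ ∉ {ℓ₁, ℓ₂}`. -/
  Λ_of_ne : ∀ ν a ℓ ℓ₁ ℓ₂, ℓ₁ ≠ ℓ → ℓ₂ ≠ ℓ → S.Λ (S.R ℓ ν) a ℓ₁ ℓ₂ ≤ S.Λ ν a ℓ₁ ℓ₂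
  /-- (21). -/
  h21 : ∀ ν ℓ, S.γf (S.R ℓ ν) ℓ ≤ (∑ ℓ' ∈ S.nbr ℓ, S.κ ℓ ℓ' * S.γf ν ℓ') +
    (S.ε : ℝ≥0∞) * ∑ a, ∑ ℓ₁ ∈ S.nbr ℓ, ∑ ℓ₂ ∈ S.nbr ℓ, S.Λ ν a ℓ₂ ℓ₁
  /-- (22). -/
  h22 : ∀ ν a ℓ ℓ₁, ℓ₁ ≠ ℓ →
    S.Λ (S.R ℓ ν) a ℓ₁ ℓ ≤ S.γf ν ℓ₁ + ∑ ℓ₂ ∈ S.nbr ℓ, S.c a ℓ ℓ₂ * S.Λ ν a ℓ₁ ℓ₂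
  /-- (23). -/
  h23 : ∀ ν a ℓ ℓ₁, ℓ₁ ≠ ℓ → S.Λ (S.R ℓ ν) a ℓ ℓ₁ ≤ ∑ ℓ₂ ∈ S.nbr ℓ, S.Λ ν a ℓ₂ ℓ₁
  /-- (24). -/
  h24 : ∀ ν a ℓ, S.Λ (S.R ℓ ν) a ℓ ℓ ≤ (∑ ℓ₁ ∈ S.nbr ℓ, S.γf ν ℓ₁) +
    ∑ ℓ₁ ∈ S.nbr ℓ, ∑ ℓ₂ ∈ S.nbr ℓ, S.c a ℓ ℓ₂ * S.Λ ν a ℓ₁ ℓ₂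

/-- RHS of (21) at `ν`. [cite: ConacheEtAl2015, Lemma 3.6 (21)] -/
def b21 (ν : St) (ℓ : ι) : ℝ≥0∞ :=
  (∑ ℓ' ∈ S.nbr ℓ, S.κ ℓ ℓ' * S.γf ν ℓ') + (S.ε : ℝ≥0∞) * ∑ a, ∑ ℓ₁ ∈ S.nbr ℓ, ∑ ℓ₂ ∈ S.nbr ℓ,
    S.Λ ν a ℓ₂ ℓ₁

/-- RHS of (50): `ℓ` reconstructed BEFORE `ℓ'` (both in the class), bound for `ν'(I_ℓ H^i_{ℓ'})`. [cite: ConacheEtAl2015, §4.2 (50)] -/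
def b50 (ν : St) (a : A) (ℓ ℓ' : ι) : ℝ≥0∞ :=
  S.b21 ν ℓ + ∑ ℓ₂ ∈ S.nbr ℓ', S.c a ℓ' ℓ₂ * S.b23 ν a ℓ ℓ₂

variable {S}

/-- Lemma 3.4 (b): `R_ℓ ν` is dominated by `ν` off `ℓ`. [cite: ConacheEtAl2015, Lemma 3.4 (b)] -/
theorem IsDPStep.domOn_R (h : S.IsDPStep) (ℓ : ι) (ν : St) : S.DomOn {x | x ≠ ℓ} (S.R ℓ ν) ν :=
  ⟨fun x hx => h.γ_of_ne ν ℓ x hx, fun a x hx y hy => h.Λ_of_ne ν a ℓ x y hx hy⟩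

section mono

variable {T : Set ι} {ν₁ ν : St} (hd : S.DomOn T ν₁ ν)
include hd

/-- (21)'s RHS is monotone in the pre-state off the resampled site. [cite: ConacheEtAl2015, Lemma 3.4 (b), §4.1 (31)–(32)] -/
theorem b21_mono {ℓ : ι} (hℓ : ∀ x ∈ S.nbr ℓ, x ∈ T) : S.b21 ν₁ ℓ ≤ S.b21 ν ℓ := by
  unfold b21
  gcongr with x hx a _ x hx y hy
  · exact hd.1 x (hℓ x hx)
  · exact hd.2 a y (hℓ y hy) x (hℓ x hx)

/-- (50)'s RHS is monotone in the pre-state off the resampled sites. [cite: ConacheEtAl2015, Lemma 3.4 (b), §4.2 (50)] -/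
theorem b50_mono {a : A} {ℓ ℓ' : ι} (hℓ : ∀ x ∈ S.nbr ℓ, x ∈ T) (hℓ' : ∀ x ∈ S.nbr ℓ', x ∈ T) :
    S.b50 ν₁ a ℓ ℓ' ≤ S.b50 ν a ℓ ℓ' := by
  unfold b50
  gcongr with x hx
  · exact b21_mono hd hℓ
  · exact b23_mono hd (hℓ' x hx) hℓ

end mono

/-- The seven bounds after one class sweep `ν' = R_{ℓₙ} ⋯ R_{ℓ₁} ν` over an INDEPENDENT list
`L = [ℓ₁, …, ℓₙ]` (no `ℓₖ` reads another: `∂ℓₖ ∩ L = ∅`), all in terms of the pre-sweep state `ν`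
(print §4.1–4.2: (31) unchanged off `L`; (32)/(45) for `I_{ℓₖ}`; (23)-rows; (22)-rows (38)/(49);
(24)-rows (52); (50) for `k < m` and (54) for `m < k`).
[cite: ConacheEtAl2015, §4.1 (31)–(38), §4.2 (45), (49), (50), (52), (54)] -/
structure ClassBounds (L : List ι) (ν ν' : St) : Prop where
  γ_off : ∀ ℓ, ℓ ∉ L → S.γf ν' ℓ ≤ S.γf ν ℓ
  Λ_off : ∀ a ℓ₁ ℓ₂, ℓ₁ ∉ L → ℓ₂ ∉ L → S.Λ ν' a ℓ₁ ℓ₂ ≤ S.Λ ν a ℓ₁ ℓ₂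
  γ_on : ∀ ℓ ∈ L, S.γf ν' ℓ ≤ S.b21 ν ℓ
  Λ_on_off : ∀ a, ∀ ℓ ∈ L, ∀ ℓ', ℓ' ∉ L → S.Λ ν' a ℓ ℓ' ≤ S.b23 ν a ℓ ℓ'
  Λ_off_on : ∀ a ℓ, ℓ ∉ L → ∀ ℓ' ∈ L, S.Λ ν' a ℓ ℓ' ≤ S.b22 ν a ℓ ℓ'
  Λ_diag : ∀ a, ∀ ℓ ∈ L, S.Λ ν' a ℓ ℓ ≤ S.b24 ν a ℓ
  Λ_on_on : ∀ a, ∀ ℓ ∈ L, ∀ ℓ' ∈ L, ℓ ≠ ℓ' → S.Λ ν' a ℓ ℓ' ≤ max (S.b50 ν a ℓ ℓ') (S.b54 ν a ℓ ℓ')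

/-- **The class sweep (§4.1–4.2, structural part).** Along an independent list of distinct sites the
one-step estimates (21)–(24) compose into `ClassBounds`: within an independent class the maps
`R_ℓ` do not interact (Lemma 3.4 (b)), so every functional is bounded by (21)–(24) applied at the
moment its last site is reconstructed, with all inputs still at their pre-sweep values.
[cite: ConacheEtAl2015, §4.1–4.2] -/
theorem IsDPStep.classBounds (h : S.IsDPStep) :
    ∀ (L : List ι), L.Nodup → (∀ x ∈ L, ∀ y ∈ S.nbr x, y ∉ L) →
      ∀ ν, S.ClassBounds L ν (S.sweepList L ν) := by
  intro L
  induction L with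
  | nil =>
    intro _ _ ν
    exact ⟨fun _ _ => le_rfl, fun _ _ _ _ _ => le_rfl, fun _ h => by simp at h,
      fun _ _ h => by simp at h, fun _ _ _ _ h => by simp at h, fun _ _ h => by simp at h,
      fun _ _ h => by simp at h⟩
  | cons ℓ L ih =>
    intro hnd hind ν
    rw [List.nodup_cons] at hnd
    obtain ⟨hℓL, hndL⟩ := hnd
    -- independence facts
    have hindL : ∀ x ∈ L, ∀ y ∈ S.nbr x, y ∉ L := fun x hx y hy hyL =>
      hind x (List.mem_cons_of_mem _ hx) y hy (List.mem_cons_of_mem _ hyL)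
    have hne : ∀ x ∈ ℓ :: L, ∀ y ∈ S.nbr x, y ≠ ℓ := fun x hx y hy hyl =>
      hind x hx y hy (hyl ▸ List.mem_cons_self)
    have hneL : ∀ x ∈ L, ∀ y ∈ S.nbr x, y ≠ ℓ := fun x hx => hne x (List.mem_cons_of_mem _ hx)
    have hneℓ : ∀ y ∈ S.nbr ℓ, y ≠ ℓ := hne ℓ List.mem_cons_self
    have hmemne : ∀ x ∈ L, x ≠ ℓ := fun x hx hxl => hℓL (hxl ▸ hx)
    set ν₁ := S.R ℓ ν with hν₁
    have hd : S.DomOn {x | x ≠ ℓ} ν₁ ν := h.domOn_R ℓ ν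
    have IH := ih hndL hindL ν₁
    rw [sweepList_cons]
    refine ⟨?_, ?_, ?_, ?_, ?_, ?_, ?_⟩
    · -- γ_off
      intro x hx
      rw [List.mem_cons, not_or] at hx
      exact (IH.γ_off x hx.2).trans (hd.1 x hx.1)
    · -- Λ_off
      intro a x y hx hy
      rw [List.mem_cons, not_or] at hx hy
      exact (IH.Λ_off a x y hx.2 hy.2).trans (hd.2 a x hx.1 y hy.1)
    · -- γ_on
      intro x hx
      rcases List.mem_cons.1 hx with rfl | hx
      · exact (IH.γ_off x hℓL).trans (h.h21 ν x)
      · exact (IH.γ_on x hx).trans (b21_mono hd (hneL x hx))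
    · -- Λ_on_off
      intro a x hx y hy
      rw [List.mem_cons, not_or] at hy
      rcases List.mem_cons.1 hx with rfl | hx
      · exact (IH.Λ_off a x y hℓL hy.2).trans (h.h23 ν a x y hy.1)
      · exact (IH.Λ_on_off a x hx y hy.2).trans (b23_mono hd hy.1 (hneL x hx))
    · -- Λ_off_on
      intro a x hx y hy
      rw [List.mem_cons, not_or] at hx
      rcases List.mem_cons.1 hy with rfl | hy
      · exact (IH.Λ_off a x y hx.2 hℓL).trans (h.h22 ν a y x hx.1)
      · exact (IH.Λ_off_on a x hx.2 y hy).trans (b22_mono hd hx.1 (hneL y hy))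
    · -- Λ_diag
      intro a x hx
      rcases List.mem_cons.1 hx with rfl | hx
      · exact (IH.Λ_off a x x hℓL hℓL).trans (h.h24 ν a x)
      · exact (IH.Λ_diag a x hx).trans (b24_mono hd (hneL x hx))
    · -- Λ_on_on
      intro a x hx y hy hxy
      rcases List.mem_cons.1 hx with hxℓ | hxL <;> rcases List.mem_cons.1 hy with hyℓ | hyL
      · exact absurd (hxℓ.trans hyℓ.symm) hxy
      · -- x = ℓ (first), y ∈ L (later): (50)
        subst hxℓ
        refine le_trans ?_ (le_max_left _ _)
        calc S.Λ (S.sweepList L ν₁) a x y ≤ S.b22 ν₁ a x y := IH.Λ_off_on a x hℓL y hyL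
          _ ≤ S.b21 ν x + ∑ ℓ₂ ∈ S.nbr y, S.c a y ℓ₂ * S.b23 ν a x ℓ₂ := by
              unfold b22
              gcongr with z hz
              · exact h.h21 ν x
              · exact h.h23 ν a x z (hneL y hyL z hz)
      · -- x ∈ L (later), y = ℓ (first): (54)
        subst hyℓ
        refine le_trans ?_ (le_max_right _ _)
        calc S.Λ (S.sweepList L ν₁) a x y ≤ S.b23 ν₁ a x y := IH.Λ_on_off a x hxL y hℓL
          _ ≤ ∑ ℓ₁ ∈ S.nbr x, S.b22 ν a ℓ₁ y := by
              unfold b23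
              gcongr with z hz
              exact h.h22 ν a y z (hneL x hxL z hz)
      · exact (IH.Λ_on_on a x hxL y hyL hxy).trans
          (max_le_max (b50_mono hd (hneL x hxL) (hneL y hyL)) (b54_mono hd (hneL x hxL) (hneL y hyL)))


/-! ### The constants: degree bound `Δ`, number of colours `χ`, `κ̄`, `c̄`, `α = AK⁻¹`, `ε = K⁻¹` -/

variable (S) in
/-- The standing hypotheses on the constants (print: (1) `Δ_ℓ ≤ Δ`, «we assume `Δ ≥ 2`»;
(9) `Σ_{ℓ'} κ_{ℓℓ'} ≤ κ̄ < 1`; (13) `Σ_{ℓ'} c_{ℓℓ'} ≤ c̄ < Δ^{−χ}`; (26a) `A = 2Δ^{χ+1}/(1 − κ̄)`;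
(26b) `AK⁻¹ < c̄/2`). Here `α` stands for the printed `AK⁻¹` and `S.ε` for `K⁻¹`; (26a) is recorded
as the inequality `(#A) Δ^{χ+1} ε ≤ α (1 − κ̄)` it is used through (with `#A = 2` marginals this is
`2Δ^{χ+1} K⁻¹ = A (1 − κ̄) K⁻¹`, i.e. the printed definition of `A`), written additively; the strict
inequalities of print are only used non-strictly. [cite: ConacheEtAl2015, §2.1 (1), §2.2 (9), (13), §3.3 (26a)–(26b)] -/
structure Admissible (Δ χ : ℕ) (κbar cbar α : ℝ≥0) : Prop where
  two_le : 2 ≤ Δ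
  card_nbr_le : ∀ ℓ, (S.nbr ℓ).card ≤ Δ
  κ_row : ∀ ℓ, ∑ ℓ' ∈ S.nbr ℓ, S.κ ℓ ℓ' ≤ κbar
  c_row : ∀ a ℓ, ∑ ℓ' ∈ S.nbr ℓ, S.c a ℓ ℓ' ≤ cbar
  κbar_le_one : κbar ≤ 1
  cbar_pow_le : cbar * (Δ : ℝ≥0) ^ χ ≤ 1
  two_mul_alpha_le : 2 * α ≤ cbar
  h26a : (Fintype.card A : ℝ≥0) * (Δ : ℝ≥0) ^ (χ + 1) * S.ε + α * κbar ≤ α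

namespace Admissible

variable {Δ χ : ℕ} {κbar cbar α : ℝ≥0} (hA : S.Admissible Δ χ κbar cbar α)
include hA

/-! Real-number consequences (all constants are finite, so we may compute in `ℝ`). -/

/-- `Δ ≥ 2` in `ℝ`. [cite: ConacheEtAl2015, §4.2 («we assume `Δ ≥ 2`»)] -/
theorem two_le_real : (2 : ℝ) ≤ Δ := by exact_mod_cast hA.two_le

/-- `Δ ≥ 1` in `ℝ`. [cite: ConacheEtAl2015, §2.1 (1)] -/
theorem one_le_real : (1 : ℝ) ≤ Δ := by linarith [hA.two_le_real]

/-- (13) in `ℝ`. [cite: ConacheEtAl2015, §2.2 (13)] -/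
theorem cbar_pow_le_real : (cbar : ℝ) * (Δ : ℝ) ^ χ ≤ 1 := by exact_mod_cast hA.cbar_pow_le

/-- (26b) in `ℝ`. [cite: ConacheEtAl2015, §3.3 (26b)] -/
theorem two_mul_alpha_le_real : 2 * (α : ℝ) ≤ cbar := by exact_mod_cast hA.two_mul_alpha_le

/-- (26a) in `ℝ`. [cite: ConacheEtAl2015, §3.3 (26a)] -/
theorem h26a_real :
    (Fintype.card A : ℝ) * (Δ : ℝ) ^ (χ + 1) * (S.ε : ℝ) + α * κbar ≤ α := by
  exact_mod_cast hA.h26a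

/-- (9) in `ℝ`. [cite: ConacheEtAl2015, §2.2 (9)] -/
theorem κbar_le_one_real : (κbar : ℝ) ≤ 1 := by exact_mod_cast hA.κbar_le_one

/-- `c̄ Δ^k ≤ 1` for `k ≤ χ`. [cite: ConacheEtAl2015, §2.2 (13)] -/
theorem cbar_mul_pow_le_one_real {k : ℕ} (hk : k ≤ χ) : (cbar : ℝ) * (Δ : ℝ) ^ k ≤ 1 :=
  le_trans (mul_le_mul_of_nonneg_left (pow_le_pow_right₀ hA.one_le_real hk) cbar.2)
    hA.cbar_pow_le_real

/-- `(#A) Δ^k ε + α κ̄ ≤ α` for `k ≤ χ + 1`. [cite: ConacheEtAl2015, §3.3 (26a)] -/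
theorem card_mul_pow_mul_eps_le_real {k : ℕ} (hk : k ≤ χ + 1) :
    (Fintype.card A : ℝ) * (Δ : ℝ) ^ k * (S.ε : ℝ) + α * κbar ≤ α := by
  have hp : (Δ : ℝ) ^ k ≤ (Δ : ℝ) ^ (χ + 1) := pow_le_pow_right₀ hA.one_le_real hk
  have : (Fintype.card A : ℝ) * (Δ : ℝ) ^ k * (S.ε : ℝ) ≤
      (Fintype.card A : ℝ) * (Δ : ℝ) ^ (χ + 1) * (S.ε : ℝ) :=
    mul_le_mul_of_nonneg_right (mul_le_mul_of_nonneg_left hp (Nat.cast_nonneg _))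
      (NNReal.coe_nonneg _)
  linarith [hA.h26a_real]

end Admissible

/-! ### Elementary summation bounds in `ℝ≥0∞` -/

section sums

variable {β : Type*} {s : Finset β}

/-- `Σ_{x∈s} f x ≤ Δ·B` when `f ≤ B` on `s` and `#s ≤ Δ`. [folklore] -/
private theorem sum_le_of_le_card {f : β → ℝ≥0∞} {B : ℝ≥0∞} {Δ : ℕ} (hs : s.card ≤ Δ)
    (hf : ∀ x ∈ s, f x ≤ B) : ∑ x ∈ s, f x ≤ (Δ : ℝ≥0∞) * B :=
  calc ∑ x ∈ s, f x ≤ ∑ _x ∈ s, B := sum_le_sum hf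
    _ = (s.card : ℝ≥0∞) * B := by rw [sum_const, nsmul_eq_mul]
    _ ≤ (Δ : ℝ≥0∞) * B := by gcongr

/-- `Σ_{x∈s} w x · f x ≤ W·B` when `f ≤ B` on `s` and `Σ w ≤ W`. [folklore] -/
private theorem sum_mul_le_of_row {w f : β → ℝ≥0∞} {W B : ℝ≥0∞} (hw : ∑ x ∈ s, w x ≤ W)
    (hf : ∀ x ∈ s, f x ≤ B) : ∑ x ∈ s, w x * f x ≤ W * B :=
  calc ∑ x ∈ s, w x * f x ≤ ∑ x ∈ s, w x * B := sum_le_sum fun x hx => mul_le_mul' le_rfl (hf x hx)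
    _ = (∑ x ∈ s, w x) * B := by rw [sum_mul]
    _ ≤ W * B := by gcongr

end sums

/-! ### The induction table (41)–(42) -/

variable (S) in
/-- **The table (41)–(42) at level `j` for the processed set `U`** (print: `U = U_{j−1}`,
`W = W_{j−1} = L ∖ U`; `γ₀ = γ(ν₀)`, `Λ₀ = λ(ν₀)`; `α = AK⁻¹`):
(41) `ν_j(I_ℓ) ≤ [κ̄ + AK⁻¹] γ₀ + 2AK⁻¹ λ₀` for `ℓ ∈ U`, `≤ γ₀` for `ℓ ∈ W`;
(42) `ν_j(I_ℓ H^i_{ℓ'}) ≤ Δ^j γ₀ + c̄Δ^{j+1} λ₀` (`ℓ, ℓ' ∈ U`), `≤ Δ^j λ₀` (`ℓ ∈ U, ℓ' ∈ W`),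
`≤ j γ₀ + c̄ λ₀` (`ℓ ∈ W, ℓ' ∈ U`), `≤ λ₀` (`ℓ, ℓ' ∈ W`).
[cite: ConacheEtAl2015, §4.2 (41)–(42)] -/
structure Table (Δ : ℕ) (κbar cbar α : ℝ≥0) (γ₀ Λ₀ : ℝ≥0∞) (U : Set ι) (j : ℕ) (ν : St) :
    Prop where
  γ_U : ∀ ℓ ∈ U, S.γf ν ℓ ≤ ((κbar : ℝ≥0∞) + α) * γ₀ + 2 * (α : ℝ≥0∞) * Λ₀
  γ_W : ∀ ℓ ∉ U, S.γf ν ℓ ≤ γ₀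
  Λ_UU : ∀ a ℓ ℓ', ℓ ∈ U → ℓ' ∈ U →
    S.Λ ν a ℓ ℓ' ≤ (Δ : ℝ≥0∞) ^ j * γ₀ + (cbar : ℝ≥0∞) * (Δ : ℝ≥0∞) ^ (j + 1) * Λ₀
  Λ_UW : ∀ a ℓ ℓ', ℓ ∈ U → ℓ' ∉ U → S.Λ ν a ℓ ℓ' ≤ (Δ : ℝ≥0∞) ^ j * Λ₀
  Λ_WU : ∀ a ℓ ℓ', ℓ ∉ U → ℓ' ∈ U → S.Λ ν a ℓ ℓ' ≤ (j : ℝ≥0∞) * γ₀ + (cbar : ℝ≥0∞) * Λ₀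
  Λ_WW : ∀ a ℓ ℓ', ℓ ∉ U → ℓ' ∉ U → S.Λ ν a ℓ ℓ' ≤ Λ₀

omit [Fintype A] in
/-- Level `0`, nothing processed: the table is just `γ(ν₀) ≤ γ₀`, `λ(ν₀) ≤ Λ₀`
(print (18), (26)). [cite: ConacheEtAl2015, §3.2 (18), (26)] -/
theorem table_empty {Δ : ℕ} {κbar cbar α : ℝ≥0} {γ₀ Λ₀ : ℝ≥0∞} {ν : St}
    (hγ : ∀ ℓ, S.γf ν ℓ ≤ γ₀) (hΛ : ∀ a ℓ ℓ', S.Λ ν a ℓ ℓ' ≤ Λ₀) :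
    S.Table Δ κbar cbar α γ₀ Λ₀ ∅ 0 ν :=
  ⟨fun _ h => h.elim, fun ℓ _ => hγ ℓ, fun _ _ _ h => h.elim, fun _ _ _ h => h.elim,
    fun _ _ _ _ h => h.elim, fun a ℓ ℓ' _ _ => hΛ a ℓ ℓ'⟩

namespace Admissible

variable {Δ χ : ℕ} {κbar cbar α : ℝ≥0} (hA : S.Admissible Δ χ κbar cbar α)
include hA

/-! Scalar inequalities between the constants, in `ℝ≥0∞` (proved through `ℝ`). -/

section scalars

/-- `(#A) Δ² ε ≤ α` (uses `χ ≥ 1`; print: «`Δ² < A`»). [cite: ConacheEtAl2015, §4.2 (after (42))] -/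
theorem eps_card_sq_le (hχ : 1 ≤ χ) :
    (S.ε : ℝ≥0∞) * ((Fintype.card A : ℝ≥0∞) * ((Δ : ℝ≥0∞) * (Δ : ℝ≥0∞))) ≤ α := by
  have h := hA.card_mul_pow_mul_eps_le_real (k := 2) (by omega)
  have hk : (0 : ℝ) ≤ α * κbar := by positivity
  have h' : (S.ε : ℝ≥0) * ((Fintype.card A : ℝ≥0) * ((Δ : ℝ≥0) * Δ)) ≤ α := by
    rw [← NNReal.coe_le_coe]; push_cast; nlinarith [h, hk]
  exact_mod_cast h'

/-- `κ̄ ≤ Δ`. [cite: ConacheEtAl2015, §2.2 (9)] -/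
theorem κbar_le_Δ : (κbar : ℝ≥0∞) ≤ (Δ : ℝ≥0∞) := by
  have h' : (κbar : ℝ≥0) ≤ (Δ : ℝ≥0) := by
    rw [← NNReal.coe_le_coe]; push_cast; linarith [hA.κbar_le_one_real, hA.one_le_real]
  exact_mod_cast h'

/-- `Δ c̄ ≤ c̄ Δ²`. [cite: ConacheEtAl2015, §4.1 (40)] -/
theorem Δ_mul_cbar_le : (Δ : ℝ≥0∞) * cbar ≤ (cbar : ℝ≥0∞) * ((Δ : ℝ≥0∞) * Δ) := by
  have h1 := hA.one_le_real
  have h' : (Δ : ℝ≥0) * cbar ≤ cbar * ((Δ : ℝ≥0) * Δ) := by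
    rw [← NNReal.coe_le_coe]; push_cast
    calc (Δ : ℝ) * cbar = cbar * ((Δ : ℝ) * 1) := by ring
      _ ≤ cbar * ((Δ : ℝ) * Δ) := by gcongr
  exact_mod_cast h'

/-- `(#A) Δ² ε + c̄ Δ ≤ c̄ Δ²` (base level; print: «`c̄Δ + 2Δ²K⁻¹ < c̄Δ + AK⁻¹ ≤ c̄Δ + c̄/2 < c̄Δ²`»). [cite: ConacheEtAl2015, §4.2 (after (42))] -/
theorem eps_card_sq_add_le (hχ : 1 ≤ χ) :
    (S.ε : ℝ≥0∞) * ((Fintype.card A : ℝ≥0∞) * ((Δ : ℝ≥0∞) * (Δ : ℝ≥0∞))) + cbar * Δ ≤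
      (cbar : ℝ≥0∞) * ((Δ : ℝ≥0∞) * Δ) := by
  have h := hA.card_mul_pow_mul_eps_le_real (k := 2) (by omega)
  have hk : (0 : ℝ) ≤ α * κbar := by positivity
  have h2 := hA.two_mul_alpha_le_real
  have hD := hA.two_le_real
  have hc0 : (0 : ℝ) ≤ cbar := cbar.2
  have hD0 : (0 : ℝ) ≤ Δ := Nat.cast_nonneg _
  have h' : (S.ε : ℝ≥0) * ((Fintype.card A : ℝ≥0) * ((Δ : ℝ≥0) * Δ)) + cbar * Δ ≤
      cbar * ((Δ : ℝ≥0) * Δ) := by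
    rw [← NNReal.coe_le_coe]; push_cast
    have e : (Fintype.card A : ℝ) * (Δ : ℝ) ^ 2 * (S.ε : ℝ) =
        (S.ε : ℝ) * ((Fintype.card A : ℝ) * ((Δ : ℝ) * Δ)) := by ring
    rw [e] at h
    have hcD : (cbar : ℝ) * 2 ≤ cbar * Δ := mul_le_mul_of_nonneg_left hD hc0
    have hcDD : (cbar : ℝ) * Δ * 2 ≤ cbar * Δ * Δ :=
      mul_le_mul_of_nonneg_left hD (mul_nonneg hc0 hD0)
    nlinarith [h, hk, h2, hcD, hcDD, hc0]
  exact_mod_cast h'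

variable {j : ℕ}

/-- `κ̄(1 + α) + (#A) Δ^{j+2} ε ≤ κ̄ + α` for `j + 1 ≤ χ` (the `γ`-coefficient of (45)). [cite: ConacheEtAl2015, §4.2 (45)–(46)] -/
theorem coeff45_γ (hjχ : j + 1 ≤ χ) :
    (κbar : ℝ≥0∞) * (1 + α) +
        (S.ε : ℝ≥0∞) * ((Fintype.card A : ℝ≥0∞) * ((Δ : ℝ≥0∞) * ((Δ : ℝ≥0∞) * (Δ : ℝ≥0∞) ^ j))) ≤
      (κbar : ℝ≥0∞) + α := by
  have h := hA.card_mul_pow_mul_eps_le_real (k := j + 2) (by omega)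
  have h' : (κbar : ℝ≥0) * (1 + α) +
      (S.ε : ℝ≥0) * ((Fintype.card A : ℝ≥0) * ((Δ : ℝ≥0) * ((Δ : ℝ≥0) * (Δ : ℝ≥0) ^ j))) ≤
      κbar + α := by
    rw [← NNReal.coe_le_coe]; push_cast
    have : (Δ : ℝ) ^ (j + 2) = Δ * (Δ * (Δ : ℝ) ^ j) := by ring
    rw [this] at h
    nlinarith [h]
  exact_mod_cast h'

/-- `κ̄·2α + (#A) Δ^{j+2} ε ≤ 2α` for `j + 1 ≤ χ` (the `λ`-coefficient of (45)). [cite: ConacheEtAl2015, §4.2 (45)–(47)] -/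
theorem coeff45_Λ (hjχ : j + 1 ≤ χ) :
    (κbar : ℝ≥0∞) * (2 * α) +
        (S.ε : ℝ≥0∞) * ((Fintype.card A : ℝ≥0∞) * ((Δ : ℝ≥0∞) * ((Δ : ℝ≥0∞) * (Δ : ℝ≥0∞) ^ j))) ≤
      2 * (α : ℝ≥0∞) := by
  have h := hA.card_mul_pow_mul_eps_le_real (k := j + 2) (by omega)
  have hK := hA.κbar_le_one_real
  have h' : (κbar : ℝ≥0) * (2 * α) +
      (S.ε : ℝ≥0) * ((Fintype.card A : ℝ≥0) * ((Δ : ℝ≥0) * ((Δ : ℝ≥0) * (Δ : ℝ≥0) ^ j))) ≤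
      2 * α := by
    rw [← NNReal.coe_le_coe]; push_cast
    have : (Δ : ℝ) ^ (j + 2) = Δ * (Δ * (Δ : ℝ) ^ j) := by ring
    rw [this] at h
    nlinarith [h, hK, mul_nonneg α.2 (sub_nonneg.2 hK)]
  exact_mod_cast h'

/-- `Δ(1 + α + c̄Δ^j) ≤ Δ^{j+1}` for `1 ≤ j`, `j + 1 ≤ χ` (the `γ`-coefficients of (48a), (51a),
(53a)). [cite: ConacheEtAl2015, §4.2 (48a), (51a), (53a)] -/
theorem coeffUU_γ (hj1 : 1 ≤ j) (hjχ : j + 1 ≤ χ) :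
    (Δ : ℝ≥0∞) * (1 + α + cbar * (Δ : ℝ≥0∞) ^ j) ≤ (Δ : ℝ≥0∞) * (Δ : ℝ≥0∞) ^ j := by
  have hC := hA.cbar_mul_pow_le_one_real (k := j + 1) hjχ
  have hCχ := hA.cbar_mul_pow_le_one_real (k := χ) le_rfl
  have h2 := hA.two_mul_alpha_le_real
  have hD := hA.two_le_real
  have ht : (2 : ℝ) ≤ (Δ : ℝ) ^ j := by
    calc (2 : ℝ) ≤ Δ := hD
      _ = (Δ : ℝ) ^ 1 := (pow_one _).symm
      _ ≤ (Δ : ℝ) ^ j := pow_le_pow_right₀ hA.one_le_real hj1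
  have hχ2 : (Δ : ℝ) ≤ (Δ : ℝ) ^ χ := by
    calc (Δ : ℝ) = (Δ : ℝ) ^ 1 := (pow_one _).symm
      _ ≤ (Δ : ℝ) ^ χ := pow_le_pow_right₀ hA.one_le_real (by omega)
  have h' : (Δ : ℝ≥0) * (1 + α + cbar * (Δ : ℝ≥0) ^ j) ≤ (Δ : ℝ≥0) * (Δ : ℝ≥0) ^ j := by
    rw [← NNReal.coe_le_coe]; push_cast
    have e : (Δ : ℝ) ^ (j + 1) = Δ * (Δ : ℝ) ^ j := by ring
    rw [e] at hC
    -- Δα ≤ Δ c̄/2 ≤ c̄Δ^χ/2 ≤ 1/2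
    have hα : (Δ : ℝ) * α ≤ 1 / 2 := by nlinarith [h2, hCχ, hχ2, cbar.2, α.2]
    nlinarith [hα, hC, ht, hD, α.2, cbar.2]
  exact_mod_cast h'

/-- `Δ(2α + c̄Δ^j) ≤ c̄Δ^{j+2}` (the `λ`-coefficients of (48a), (51b), (53b)). [cite: ConacheEtAl2015, §4.2 (48a), (51b), (53b)] -/
theorem coeffUU_Λ :
    (Δ : ℝ≥0∞) * (2 * α + cbar * (Δ : ℝ≥0∞) ^ j) ≤
      (cbar : ℝ≥0∞) * ((Δ : ℝ≥0∞) * ((Δ : ℝ≥0∞) * (Δ : ℝ≥0∞) ^ j)) := by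
  have h2 := hA.two_mul_alpha_le_real
  have hD := hA.two_le_real
  have ht : (1 : ℝ) ≤ (Δ : ℝ) ^ j := one_le_pow₀ hA.one_le_real
  have hc0 : (0 : ℝ) ≤ cbar := cbar.2
  have hD0 : (0 : ℝ) ≤ Δ := Nat.cast_nonneg _
  have h' : (Δ : ℝ≥0) * (2 * α + cbar * (Δ : ℝ≥0) ^ j) ≤
      cbar * ((Δ : ℝ≥0) * ((Δ : ℝ≥0) * (Δ : ℝ≥0) ^ j)) := by
    rw [← NNReal.coe_le_coe]; push_cast
    have ht1 : (1 : ℝ) + (Δ : ℝ) ^ j ≤ Δ * (Δ : ℝ) ^ j := by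
      nlinarith [mul_nonneg (sub_nonneg.2 hD) (le_trans zero_le_one ht), ht]
    calc (Δ : ℝ) * (2 * α + cbar * (Δ : ℝ) ^ j) ≤ Δ * (cbar + cbar * (Δ : ℝ) ^ j) := by
          gcongr
      _ = cbar * Δ * (1 + (Δ : ℝ) ^ j) := by ring
      _ ≤ cbar * Δ * (Δ * (Δ : ℝ) ^ j) :=
          mul_le_mul_of_nonneg_left ht1 (mul_nonneg hc0 hD0)
      _ = cbar * ((Δ : ℝ) * ((Δ : ℝ) * (Δ : ℝ) ^ j)) := by ring
  exact_mod_cast h'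

/-- `1 + c̄ j ≤ j + 1` (the `γ`-coefficient of (49)). [cite: ConacheEtAl2015, §4.2 (49)] -/
theorem coeffWU_γ : (1 : ℝ≥0∞) + cbar * (j : ℝ≥0∞) ≤ ((j + 1 : ℕ) : ℝ≥0∞) := by
  have hC : (cbar : ℝ) ≤ 1 := by
    have := hA.cbar_mul_pow_le_one_real (k := 0) (Nat.zero_le _)
    simpa using this
  have h' : (1 : ℝ≥0) + cbar * (j : ℝ≥0) ≤ ((j + 1 : ℕ) : ℝ≥0) := by
    rw [← NNReal.coe_le_coe]; push_cast
    nlinarith [hC, (Nat.cast_nonneg j : (0:ℝ) ≤ j)]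
  exact_mod_cast h'

/-- `c̄ ≤ 1`. [cite: ConacheEtAl2015, §2.2 (13)] -/
theorem cbar_le_one : (cbar : ℝ≥0∞) ≤ 1 := by
  have h' : (cbar : ℝ≥0) ≤ 1 := by
    rw [← NNReal.coe_le_coe]; push_cast
    have := hA.cbar_mul_pow_le_one_real (k := 0) (Nat.zero_le _)
    simpa using this
  exact_mod_cast h'

/-- `c̄ Δ^{j+1} ≤ Δ^j` (from `c̄Δ ≤ 1`, i.e. `χ ≥ 1`). [cite: ConacheEtAl2015, §2.2 (13)] -/
theorem cbar_pow_succ_le (hχ : 1 ≤ χ) :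
    (cbar : ℝ≥0∞) * (Δ : ℝ≥0∞) ^ (j + 1) ≤ (Δ : ℝ≥0∞) ^ j := by
  have hC := hA.cbar_mul_pow_le_one_real (k := 1) hχ
  have h' : (cbar : ℝ≥0) * (Δ : ℝ≥0) ^ (j + 1) ≤ (Δ : ℝ≥0) ^ j := by
    rw [← NNReal.coe_le_coe]; push_cast
    rw [pow_one] at hC
    have ht : (0 : ℝ) ≤ (Δ : ℝ) ^ j := by positivity
    calc (cbar : ℝ) * (Δ : ℝ) ^ (j + 1) = (cbar * Δ) * (Δ : ℝ) ^ j := by ring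
      _ ≤ 1 * (Δ : ℝ) ^ j := mul_le_mul_of_nonneg_right hC ht
      _ = (Δ : ℝ) ^ j := one_mul _
  exact_mod_cast h'

omit hA in
/-- `j ≤ Δ^j` for `Δ ≥ 2` («hence, `j ≤ Δ^j`»). [cite: ConacheEtAl2015, §4.2 (46)] -/
theorem cast_le_pow (hΔ : 2 ≤ Δ) : (j : ℝ≥0∞) ≤ (Δ : ℝ≥0∞) ^ j := by
  have h : j ≤ Δ ^ j := by
    calc j ≤ 2 ^ j := Nat.lt_two_pow_self.le
      _ ≤ Δ ^ j := Nat.pow_le_pow_left hΔ j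
  exact_mod_cast h

omit hA in
/-- `1 ≤ Δ^j` for `Δ ≥ 2`. [cite: ConacheEtAl2015, §4.2 («we assume `Δ ≥ 2`»)] -/
theorem one_le_pow' (hΔ : 2 ≤ Δ) : (1 : ℝ≥0∞) ≤ (Δ : ℝ≥0∞) ^ j := by
  have h : 1 ≤ Δ ^ j := Nat.one_le_pow _ _ (by omega)
  exact_mod_cast h

end scalars

end Admissible

/-! ### Uniform row/column consequences of the table -/

namespace Table

variable {Δ χ : ℕ} {κbar cbar α : ℝ≥0} {γ₀ Λ₀ : ℝ≥0∞} {U : Set ι} {j : ℕ} {ν : St}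
  (hT : S.Table Δ κbar cbar α γ₀ Λ₀ U j ν) (hA : S.Admissible Δ χ κbar cbar α)
include hT hA

/-- Every `ν(I_ℓ)` is `≤ (1 + α)γ₀ + 2αΛ₀` (both rows of (41), `κ̄ ≤ 1`). [cite: ConacheEtAl2015, §4.2 (41)] -/
theorem γ_all (ℓ : ι) : S.γf ν ℓ ≤ (1 + (α : ℝ≥0∞)) * γ₀ + 2 * (α : ℝ≥0∞) * Λ₀ := by
  by_cases hℓ : ℓ ∈ U
  · refine (hT.γ_U ℓ hℓ).trans ?_
    gcongr
    exact_mod_cast hA.κbar_le_one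
  · calc S.γf ν ℓ ≤ γ₀ := hT.γ_W ℓ hℓ
      _ = 1 * γ₀ + 0 := by ring
      _ ≤ (1 + (α : ℝ≥0∞)) * γ₀ + 2 * (α : ℝ≥0∞) * Λ₀ := by gcongr <;> simp

/-- Column bound, `ℓ' ∈ U`: `ν(I_ℓ H_{ℓ'}) ≤ Δ^j γ₀ + c̄Δ^{j+1} Λ₀` (rows 1 and 3 of (42);
`j ≤ Δ^j`, `1 ≤ Δ^{j+1}`). [cite: ConacheEtAl2015, §4.2 (42)] -/
theorem Λ_colU (a : A) (ℓ : ι) {ℓ' : ι} (hℓ' : ℓ' ∈ U) :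
    S.Λ ν a ℓ ℓ' ≤ (Δ : ℝ≥0∞) ^ j * γ₀ + (cbar : ℝ≥0∞) * (Δ : ℝ≥0∞) ^ (j + 1) * Λ₀ := by
  by_cases hℓ : ℓ ∈ U
  · exact hT.Λ_UU a ℓ ℓ' hℓ hℓ'
  · refine (hT.Λ_WU a ℓ ℓ' hℓ hℓ').trans ?_
    have h1 : (j : ℝ≥0∞) ≤ (Δ : ℝ≥0∞) ^ j := Admissible.cast_le_pow hA.two_le
    have h2 : (cbar : ℝ≥0∞) ≤ (cbar : ℝ≥0∞) * (Δ : ℝ≥0∞) ^ (j + 1) :=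
      le_mul_of_one_le_right' (Admissible.one_le_pow' hA.two_le)
    gcongr

/-- Column bound, `ℓ' ∉ U`: `ν(I_ℓ H_{ℓ'}) ≤ Δ^j Λ₀` (rows 2 and 4 of (42)). [cite: ConacheEtAl2015, §4.2 (42)] -/
theorem Λ_colW (a : A) (ℓ : ι) {ℓ' : ι} (hℓ' : ℓ' ∉ U) :
    S.Λ ν a ℓ ℓ' ≤ (Δ : ℝ≥0∞) ^ j * Λ₀ := by
  by_cases hℓ : ℓ ∈ U
  · exact hT.Λ_UW a ℓ ℓ' hℓ hℓ'
  · exact (hT.Λ_WW a ℓ ℓ' hℓ hℓ').trans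
      (le_mul_of_one_le_left' (Admissible.one_le_pow' hA.two_le))

/-- Row bound, `ℓ ∉ U`: `ν(I_ℓ H_{ℓ'}) ≤ j γ₀ + Λ₀` (rows 3 and 4 of (42); `c̄ ≤ 1`). [cite: ConacheEtAl2015, §4.2 (42)] -/
theorem Λ_rowW (a : A) {ℓ : ι} (hℓ : ℓ ∉ U) (ℓ' : ι) :
    S.Λ ν a ℓ ℓ' ≤ (j : ℝ≥0∞) * γ₀ + Λ₀ := by
  by_cases hℓ' : ℓ' ∈ U
  · refine (hT.Λ_WU a ℓ ℓ' hℓ hℓ').trans ?_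
    gcongr
    exact mul_le_of_le_one_left' hA.cbar_le_one
  · exact (hT.Λ_WW a ℓ ℓ' hℓ hℓ').trans le_add_self

/-- Global bound: `ν(I_ℓ H_{ℓ'}) ≤ Δ^j (γ₀ + Λ₀)` (all rows of (42); `c̄Δ^{j+1} ≤ Δ^j`, `j ≤ Δ^j`). [cite: ConacheEtAl2015, §4.2 (42)] -/
theorem Λ_all (hχ : 1 ≤ χ) (a : A) (ℓ ℓ' : ι) :
    S.Λ ν a ℓ ℓ' ≤ (Δ : ℝ≥0∞) ^ j * (γ₀ + Λ₀) := by
  have h1 : (j : ℝ≥0∞) ≤ (Δ : ℝ≥0∞) ^ j := Admissible.cast_le_pow hA.two_le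
  have h2 : (1 : ℝ≥0∞) ≤ (Δ : ℝ≥0∞) ^ j := Admissible.one_le_pow' hA.two_le
  have h3 : (cbar : ℝ≥0∞) * (Δ : ℝ≥0∞) ^ (j + 1) ≤ (Δ : ℝ≥0∞) ^ j := hA.cbar_pow_succ_le hχ
  rw [mul_add]
  by_cases hℓ' : ℓ' ∈ U
  · refine (hT.Λ_colU hA a ℓ hℓ').trans ?_
    gcongr
  · calc S.Λ ν a ℓ ℓ' ≤ (Δ : ℝ≥0∞) ^ j * Λ₀ := hT.Λ_colW hA a ℓ hℓ'
      _ ≤ (Δ : ℝ≥0∞) ^ j * γ₀ + (Δ : ℝ≥0∞) ^ j * Λ₀ := le_add_self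

end Table

/-! ### §4.1: the first class (level 0 → 1) -/

namespace Admissible

variable {Δ χ : ℕ} {κbar cbar α : ℝ≥0} (hA : S.Admissible Δ χ κbar cbar α)
include hA

/-- `1 ≤ Δ`. [cite: ConacheEtAl2015, §2.1 (1)] -/
theorem one_le_Δ : (1 : ℝ≥0∞) ≤ (Δ : ℝ≥0∞) := by
  have : 1 ≤ Δ := le_trans (by norm_num) hA.two_le
  exact_mod_cast this

/-- **§4.1 (39)–(40).** Reconstruction over the first independent class `V₀ = L`: from
`γ(ν₀) ≤ γ₀`, `λ(ν₀) ≤ Λ₀` to the level-`1` table for `U₀ = V₀`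
(«(39) `ν₁(I_ℓ) ≤ κ̄γ₀ + 2Δ²K⁻¹λ₀` for `ℓ ∈ V₀`, `γ₀` for `ℓ ∈ W₀`; (40) `ν₁(I_ℓ H^i_{ℓ'}) ≤ Δγ₀ +
[Δc̄ + 2Δ²K⁻¹]λ₀`, `Δλ₀`, `γ₀ + c̄λ₀`, `λ₀`», and «(39) agrees with (41) as `Δ² < A` … (40) agrees
with (42)»). [cite: ConacheEtAl2015, §4.1 (31)–(40)] -/
theorem table_base (hχ : 1 ≤ χ) {γ₀ Λ₀ : ℝ≥0∞} {ν ν' : St} (hγ : ∀ ℓ, S.γf ν ℓ ≤ γ₀)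
    (hΛ : ∀ a ℓ ℓ', S.Λ ν a ℓ ℓ' ≤ Λ₀) {L : List ι} (hB : S.ClassBounds L ν ν') :
    S.Table Δ κbar cbar α γ₀ Λ₀ {x | x ∈ L} 1 ν' := by
  have hcard := hA.card_nbr_le
  -- the sums at `ν`
  have hb21 : ∀ ℓ, S.b21 ν ℓ ≤ (κbar : ℝ≥0∞) * γ₀ +
      (S.ε : ℝ≥0∞) * ((Fintype.card A : ℝ≥0∞) * ((Δ : ℝ≥0∞) * ((Δ : ℝ≥0∞) * Λ₀))) := by
    intro ℓ
    refine add_le_add (sum_mul_le_of_row (hA.κ_row ℓ) fun x _ => hγ x) (mul_le_mul' le_rfl ?_)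
    calc ∑ a, ∑ x ∈ S.nbr ℓ, ∑ y ∈ S.nbr ℓ, S.Λ ν a y x
        ≤ ∑ _a : A, (Δ : ℝ≥0∞) * ((Δ : ℝ≥0∞) * Λ₀) :=
          sum_le_sum fun a _ => sum_le_of_le_card (hcard ℓ) fun x _ =>
            sum_le_of_le_card (hcard ℓ) fun y _ => hΛ a y x
      _ = (Fintype.card A : ℝ≥0∞) * ((Δ : ℝ≥0∞) * ((Δ : ℝ≥0∞) * Λ₀)) := by
          rw [sum_const, nsmul_eq_mul, card_univ]
  have hb23 : ∀ a ℓ y, S.b23 ν a ℓ y ≤ (Δ : ℝ≥0∞) * Λ₀ := fun a ℓ y =>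
    sum_le_of_le_card (hcard ℓ) fun x _ => hΛ a x y
  have hb22 : ∀ a x ℓ', S.b22 ν a x ℓ' ≤ γ₀ + (cbar : ℝ≥0∞) * Λ₀ := fun a x ℓ' =>
    add_le_add (hγ x) (sum_mul_le_of_row (hA.c_row a ℓ') fun y _ => hΛ a x y)
  have hb24 : ∀ a ℓ, S.b24 ν a ℓ ≤ (Δ : ℝ≥0∞) * γ₀ + (Δ : ℝ≥0∞) * ((cbar : ℝ≥0∞) * Λ₀) :=
    fun a ℓ => add_le_add (sum_le_of_le_card (hcard ℓ) fun x _ => hγ x)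
      (sum_le_of_le_card (hcard ℓ) fun x _ => sum_mul_le_of_row (hA.c_row a ℓ) fun y _ => hΛ a x y)
  have hb50 : ∀ a ℓ ℓ', S.b50 ν a ℓ ℓ' ≤ (κbar : ℝ≥0∞) * γ₀ +
      (S.ε : ℝ≥0∞) * ((Fintype.card A : ℝ≥0∞) * ((Δ : ℝ≥0∞) * ((Δ : ℝ≥0∞) * Λ₀))) +
      (cbar : ℝ≥0∞) * ((Δ : ℝ≥0∞) * Λ₀) := fun a ℓ ℓ' =>
    add_le_add (hb21 ℓ) (sum_mul_le_of_row (hA.c_row a ℓ') fun y _ => hb23 a ℓ y)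
  have hb54 : ∀ a ℓ ℓ', S.b54 ν a ℓ ℓ' ≤ (Δ : ℝ≥0∞) * (γ₀ + (cbar : ℝ≥0∞) * Λ₀) :=
    fun a ℓ ℓ' => sum_le_of_le_card (hcard ℓ) fun x _ => hb22 a x ℓ'
  -- scalar facts
  have s1 := hA.eps_card_sq_le hχ
  have s2 := hA.κbar_le_Δ
  have s3 := hA.Δ_mul_cbar_le
  have s4 := hA.eps_card_sq_add_le hχ
  have hUU : ∀ a, ∀ ℓ ∈ L, ∀ ℓ' ∈ L, S.Λ ν' a ℓ ℓ' ≤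
      (Δ : ℝ≥0∞) * γ₀ + (cbar : ℝ≥0∞) * ((Δ : ℝ≥0∞) * (Δ : ℝ≥0∞)) * Λ₀ := by
    intro a ℓ hℓ ℓ' hℓ'
    by_cases hne : ℓ = ℓ'
    · subst hne
      calc S.Λ ν' a ℓ ℓ ≤ S.b24 ν a ℓ := hB.Λ_diag a ℓ hℓ
        _ ≤ (Δ : ℝ≥0∞) * γ₀ + (Δ : ℝ≥0∞) * ((cbar : ℝ≥0∞) * Λ₀) := hb24 a ℓ
        _ = (Δ : ℝ≥0∞) * γ₀ + ((Δ : ℝ≥0∞) * (cbar : ℝ≥0∞)) * Λ₀ := by ring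
        _ ≤ (Δ : ℝ≥0∞) * γ₀ + (cbar : ℝ≥0∞) * ((Δ : ℝ≥0∞) * (Δ : ℝ≥0∞)) * Λ₀ := by
            gcongr
    · refine (hB.Λ_on_on a ℓ hℓ ℓ' hℓ' hne).trans (max_le ?_ ?_)
      · calc S.b50 ν a ℓ ℓ' ≤ _ := hb50 a ℓ ℓ'
          _ = (κbar : ℝ≥0∞) * γ₀ + ((S.ε : ℝ≥0∞) * ((Fintype.card A : ℝ≥0∞) *
                ((Δ : ℝ≥0∞) * (Δ : ℝ≥0∞))) + (cbar : ℝ≥0∞) * Δ) * Λ₀ := by ring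
          _ ≤ (Δ : ℝ≥0∞) * γ₀ + (cbar : ℝ≥0∞) * ((Δ : ℝ≥0∞) * (Δ : ℝ≥0∞)) * Λ₀ := by
              gcongr
      · calc S.b54 ν a ℓ ℓ' ≤ _ := hb54 a ℓ ℓ'
          _ = (Δ : ℝ≥0∞) * γ₀ + ((Δ : ℝ≥0∞) * (cbar : ℝ≥0∞)) * Λ₀ := by ring
          _ ≤ (Δ : ℝ≥0∞) * γ₀ + (cbar : ℝ≥0∞) * ((Δ : ℝ≥0∞) * (Δ : ℝ≥0∞)) * Λ₀ := by
              gcongr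
  refine ⟨?_, ?_, ?_, ?_, ?_, ?_⟩
  · -- γ_U : (39) first row, then `Δ² K⁻¹ ≤ AK⁻¹`
    intro ℓ hℓ
    calc S.γf ν' ℓ ≤ S.b21 ν ℓ := hB.γ_on ℓ hℓ
      _ ≤ _ := hb21 ℓ
      _ = (κbar : ℝ≥0∞) * γ₀ + ((S.ε : ℝ≥0∞) * ((Fintype.card A : ℝ≥0∞) *
            ((Δ : ℝ≥0∞) * (Δ : ℝ≥0∞)))) * Λ₀ := by ring
      _ ≤ ((κbar : ℝ≥0∞) + α) * γ₀ + 2 * (α : ℝ≥0∞) * Λ₀ := by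
          have hα2 : (α : ℝ≥0∞) ≤ 2 * (α : ℝ≥0∞) := by rw [two_mul]; exact le_self_add
          exact add_le_add (mul_le_mul' le_self_add le_rfl) (mul_le_mul' (s1.trans hα2) le_rfl)
  · -- γ_W : (31)
    intro ℓ hℓ
    exact (hB.γ_off ℓ hℓ).trans (hγ ℓ)
  · -- Λ_UU : (40) first row
    intro a ℓ ℓ' hℓ hℓ'
    calc S.Λ ν' a ℓ ℓ' ≤ _ := hUU a ℓ hℓ ℓ' hℓ'
      _ = (Δ : ℝ≥0∞) ^ 1 * γ₀ + (cbar : ℝ≥0∞) * (Δ : ℝ≥0∞) ^ (1 + 1) * Λ₀ := by ring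
  · -- Λ_UW : (40) second row
    intro a ℓ ℓ' hℓ hℓ'
    calc S.Λ ν' a ℓ ℓ' ≤ S.b23 ν a ℓ ℓ' := hB.Λ_on_off a ℓ hℓ ℓ' hℓ'
      _ ≤ (Δ : ℝ≥0∞) * Λ₀ := hb23 a ℓ ℓ'
      _ = (Δ : ℝ≥0∞) ^ 1 * Λ₀ := by rw [pow_one]
  · -- Λ_WU : (40) third row
    intro a ℓ ℓ' hℓ hℓ'
    calc S.Λ ν' a ℓ ℓ' ≤ S.b22 ν a ℓ ℓ' := hB.Λ_off_on a ℓ hℓ ℓ' hℓ'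
      _ ≤ γ₀ + (cbar : ℝ≥0∞) * Λ₀ := hb22 a ℓ ℓ'
      _ = ((1 : ℕ) : ℝ≥0∞) * γ₀ + (cbar : ℝ≥0∞) * Λ₀ := by simp
  · -- Λ_WW : (31)
    intro a ℓ ℓ' hℓ hℓ'
    exact (hB.Λ_off a ℓ ℓ' hℓ hℓ').trans (hΛ a ℓ ℓ')

end Admissible

/-! ### §4.2: the induction step (level `j ≥ 1` → `j + 1`) -/

namespace Admissible

variable {Δ χ : ℕ} {κbar cbar α : ℝ≥0} (hA : S.Admissible Δ χ κbar cbar α)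
include hA

/-- **§4.2, proof of Lemma 3.7: (41)–(42) at level `j` ⟹ (41)–(42) at level `j + 1`** after the
reconstruction over the next independent class `V_j = L` (`U_j = U_{j−1} ∪ V_j`), for
`1 ≤ j ≤ χ − 1`; the arithmetic is (45)–(48a), (49), (50)–(51b), (52)–(53b), (54) of print, organised
through the uniform row/column bounds of `Table`. [cite: ConacheEtAl2015, §4.2 (41)–(54)] -/
theorem table_step {j : ℕ} (hj1 : 1 ≤ j) (hjχ : j + 1 ≤ χ) {γ₀ Λ₀ : ℝ≥0∞} {U : Set ι}
    {ν ν' : St} (hT : S.Table Δ κbar cbar α γ₀ Λ₀ U j ν) {L : List ι}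
    (hB : S.ClassBounds L ν ν') :
    S.Table Δ κbar cbar α γ₀ Λ₀ (U ∪ {x | x ∈ L}) (j + 1) ν' := by
  have hχ : 1 ≤ χ := by omega
  have hcard := hA.card_nbr_le
  have h1D := hA.one_le_Δ
  -- notation-free abbreviations of the uniform bounds
  have hΓ := hT.γ_all hA
  have hΘ := hT.Λ_all hA hχ
  have hCU := fun a ℓ ℓ' (h : ℓ' ∈ U) => hT.Λ_colU hA a ℓ h
  have hCW := fun a ℓ ℓ' (h : ℓ' ∉ U) => hT.Λ_colW hA a ℓ h
  have hRW := fun a ℓ (h : ℓ ∉ U) ℓ' => hT.Λ_rowW hA a h ℓ'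
  -- the sums at `ν`
  set Γ : ℝ≥0∞ := (1 + (α : ℝ≥0∞)) * γ₀ + 2 * (α : ℝ≥0∞) * Λ₀ with hΓdef
  set Θ : ℝ≥0∞ := (Δ : ℝ≥0∞) ^ j * (γ₀ + Λ₀) with hΘdef
  have hb21 : ∀ ℓ, S.b21 ν ℓ ≤ (κbar : ℝ≥0∞) * Γ +
      (S.ε : ℝ≥0∞) * ((Fintype.card A : ℝ≥0∞) * ((Δ : ℝ≥0∞) * ((Δ : ℝ≥0∞) * Θ))) := by
    intro ℓ
    refine add_le_add (sum_mul_le_of_row (hA.κ_row ℓ) fun x _ => hΓ x) (mul_le_mul' le_rfl ?_)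
    calc ∑ a, ∑ x ∈ S.nbr ℓ, ∑ y ∈ S.nbr ℓ, S.Λ ν a y x
        ≤ ∑ _a : A, (Δ : ℝ≥0∞) * ((Δ : ℝ≥0∞) * Θ) :=
          sum_le_sum fun a _ => sum_le_of_le_card (hcard ℓ) fun x _ =>
            sum_le_of_le_card (hcard ℓ) fun y _ => hΘ a y x
      _ = (Fintype.card A : ℝ≥0∞) * ((Δ : ℝ≥0∞) * ((Δ : ℝ≥0∞) * Θ)) := by
          rw [sum_const, nsmul_eq_mul, card_univ]
  have hb23U : ∀ a ℓ y, y ∈ U → S.b23 ν a ℓ y ≤ (Δ : ℝ≥0∞) *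
      ((Δ : ℝ≥0∞) ^ j * γ₀ + (cbar : ℝ≥0∞) * (Δ : ℝ≥0∞) ^ (j + 1) * Λ₀) :=
    fun a ℓ y hy => sum_le_of_le_card (hcard ℓ) fun x _ => hCU a x y hy
  have hb23W : ∀ a ℓ y, y ∉ U → S.b23 ν a ℓ y ≤ (Δ : ℝ≥0∞) * ((Δ : ℝ≥0∞) ^ j * Λ₀) :=
    fun a ℓ y hy => sum_le_of_le_card (hcard ℓ) fun x _ => hCW a x y hy
  have hb23 : ∀ a ℓ y, S.b23 ν a ℓ y ≤ (Δ : ℝ≥0∞) * Θ :=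
    fun a ℓ y => sum_le_of_le_card (hcard ℓ) fun x _ => hΘ a x y
  have hb22 : ∀ a x ℓ', S.b22 ν a x ℓ' ≤ Γ + (cbar : ℝ≥0∞) * Θ := fun a x ℓ' =>
    add_le_add (hΓ x) (sum_mul_le_of_row (hA.c_row a ℓ') fun y _ => hΘ a x y)
  have hb22W : ∀ a x ℓ', x ∉ U → S.b22 ν a x ℓ' ≤ γ₀ + (cbar : ℝ≥0∞) * ((j : ℝ≥0∞) * γ₀ + Λ₀) :=
    fun a x ℓ' hx => add_le_add (hT.γ_W x hx)
      (sum_mul_le_of_row (hA.c_row a ℓ') fun y _ => hRW a x hx y)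
  have hb24 : ∀ a ℓ, S.b24 ν a ℓ ≤ (Δ : ℝ≥0∞) * Γ + (Δ : ℝ≥0∞) * ((cbar : ℝ≥0∞) * Θ) :=
    fun a ℓ => add_le_add (sum_le_of_le_card (hcard ℓ) fun x _ => hΓ x)
      (sum_le_of_le_card (hcard ℓ) fun x _ => sum_mul_le_of_row (hA.c_row a ℓ) fun y _ => hΘ a x y)
  have hb50 : ∀ a ℓ ℓ', S.b50 ν a ℓ ℓ' ≤ (κbar : ℝ≥0∞) * Γ +
      (S.ε : ℝ≥0∞) * ((Fintype.card A : ℝ≥0∞) * ((Δ : ℝ≥0∞) * ((Δ : ℝ≥0∞) * Θ))) +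
      (cbar : ℝ≥0∞) * ((Δ : ℝ≥0∞) * Θ) := fun a ℓ ℓ' =>
    add_le_add (hb21 ℓ) (sum_mul_le_of_row (hA.c_row a ℓ') fun y _ => hb23 a ℓ y)
  have hb54 : ∀ a ℓ ℓ', S.b54 ν a ℓ ℓ' ≤ (Δ : ℝ≥0∞) * (Γ + (cbar : ℝ≥0∞) * Θ) :=
    fun a ℓ ℓ' => sum_le_of_le_card (hcard ℓ) fun x _ => hb22 a x ℓ'
  -- scalar facts
  have c45γ := hA.coeff45_γ (j := j) hjχ
  have c45Λ := hA.coeff45_Λ (j := j) hjχ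
  have cUUγ := hA.coeffUU_γ (j := j) hj1 hjχ
  have cUUΛ := hA.coeffUU_Λ (j := j)
  have cWU := hA.coeffWU_γ (j := j)
  -- (45): the `γ_on` comparison
  have h45 : (κbar : ℝ≥0∞) * Γ +
      (S.ε : ℝ≥0∞) * ((Fintype.card A : ℝ≥0∞) * ((Δ : ℝ≥0∞) * ((Δ : ℝ≥0∞) * Θ))) ≤
      ((κbar : ℝ≥0∞) + α) * γ₀ + 2 * (α : ℝ≥0∞) * Λ₀ := by
    rw [hΓdef, hΘdef]
    calc (κbar : ℝ≥0∞) * ((1 + (α : ℝ≥0∞)) * γ₀ + 2 * (α : ℝ≥0∞) * Λ₀) +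
          (S.ε : ℝ≥0∞) * ((Fintype.card A : ℝ≥0∞) *
            ((Δ : ℝ≥0∞) * ((Δ : ℝ≥0∞) * ((Δ : ℝ≥0∞) ^ j * (γ₀ + Λ₀)))))
        = ((κbar : ℝ≥0∞) * (1 + α) + (S.ε : ℝ≥0∞) * ((Fintype.card A : ℝ≥0∞) *
            ((Δ : ℝ≥0∞) * ((Δ : ℝ≥0∞) * (Δ : ℝ≥0∞) ^ j)))) * γ₀ +
          ((κbar : ℝ≥0∞) * (2 * α) + (S.ε : ℝ≥0∞) * ((Fintype.card A : ℝ≥0∞) *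
            ((Δ : ℝ≥0∞) * ((Δ : ℝ≥0∞) * (Δ : ℝ≥0∞) ^ j)))) * Λ₀ := by ring
      _ ≤ ((κbar : ℝ≥0∞) + α) * γ₀ + 2 * (α : ℝ≥0∞) * Λ₀ :=
          add_le_add (mul_le_mul' c45γ le_rfl) (mul_le_mul' c45Λ le_rfl)
  -- (48a)/(51)/(53): the `UU` comparison, master form
  have hUUm : (Δ : ℝ≥0∞) * Γ + (Δ : ℝ≥0∞) * ((cbar : ℝ≥0∞) * Θ) ≤
      (Δ : ℝ≥0∞) ^ (j + 1) * γ₀ + (cbar : ℝ≥0∞) * (Δ : ℝ≥0∞) ^ (j + 1 + 1) * Λ₀ := by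
    rw [hΓdef, hΘdef]
    calc (Δ : ℝ≥0∞) * ((1 + (α : ℝ≥0∞)) * γ₀ + 2 * (α : ℝ≥0∞) * Λ₀) +
          (Δ : ℝ≥0∞) * ((cbar : ℝ≥0∞) * ((Δ : ℝ≥0∞) ^ j * (γ₀ + Λ₀)))
        = (Δ : ℝ≥0∞) * (1 + α + (cbar : ℝ≥0∞) * (Δ : ℝ≥0∞) ^ j) * γ₀ +
          (Δ : ℝ≥0∞) * (2 * α + (cbar : ℝ≥0∞) * (Δ : ℝ≥0∞) ^ j) * Λ₀ := by ring
      _ ≤ (Δ : ℝ≥0∞) * (Δ : ℝ≥0∞) ^ j * γ₀ +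
          (cbar : ℝ≥0∞) * ((Δ : ℝ≥0∞) * ((Δ : ℝ≥0∞) * (Δ : ℝ≥0∞) ^ j)) * Λ₀ :=
          add_le_add (mul_le_mul' cUUγ le_rfl) (mul_le_mul' cUUΛ le_rfl)
      _ = (Δ : ℝ≥0∞) ^ (j + 1) * γ₀ + (cbar : ℝ≥0∞) * (Δ : ℝ≥0∞) ^ (j + 1 + 1) * Λ₀ := by
          ring
  have hΓC : Γ + (cbar : ℝ≥0∞) * Θ ≤ (Δ : ℝ≥0∞) * Γ + (Δ : ℝ≥0∞) * ((cbar : ℝ≥0∞) * Θ) :=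
    add_le_add (le_mul_of_one_le_left' h1D) (le_mul_of_one_le_left' h1D)
  have h50 : (κbar : ℝ≥0∞) * Γ +
      (S.ε : ℝ≥0∞) * ((Fintype.card A : ℝ≥0∞) * ((Δ : ℝ≥0∞) * ((Δ : ℝ≥0∞) * Θ))) +
      (cbar : ℝ≥0∞) * ((Δ : ℝ≥0∞) * Θ) ≤
      (Δ : ℝ≥0∞) * Γ + (Δ : ℝ≥0∞) * ((cbar : ℝ≥0∞) * Θ) := by
    refine add_le_add (h45.trans ?_) (le_of_eq (by ring))
    calc ((κbar : ℝ≥0∞) + α) * γ₀ + 2 * (α : ℝ≥0∞) * Λ₀ ≤ Γ := by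
          rw [hΓdef]; gcongr; exact_mod_cast hA.κbar_le_one
      _ ≤ (Δ : ℝ≥0∞) * Γ := le_mul_of_one_le_left' h1D
  -- monotonicity of the old table entries in `j`
  have hjD : (Δ : ℝ≥0∞) ^ j ≤ (Δ : ℝ≥0∞) ^ (j + 1) := pow_le_pow_right₀ h1D (by omega)
  have hjD' : (Δ : ℝ≥0∞) ^ (j + 1) ≤ (Δ : ℝ≥0∞) ^ (j + 1 + 1) :=
    pow_le_pow_right₀ h1D (by omega)
  have hjj : (j : ℝ≥0∞) ≤ ((j + 1 : ℕ) : ℝ≥0∞) := by exact_mod_cast Nat.le_succ j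
  refine ⟨?_, ?_, ?_, ?_, ?_, ?_⟩
  · -- γ_U
    intro ℓ hℓ
    by_cases hL : ℓ ∈ L
    · exact (hB.γ_on ℓ hL).trans ((hb21 ℓ).trans h45)
    · have hU : ℓ ∈ U := by
        rcases hℓ with h | h
        · exact h
        · exact absurd h hL
      exact (hB.γ_off ℓ hL).trans (hT.γ_U ℓ hU)
  · -- γ_W
    intro ℓ hℓ
    simp only [Set.mem_union, Set.mem_setOf_eq, not_or] at hℓ
    exact (hB.γ_off ℓ hℓ.2).trans (hT.γ_W ℓ hℓ.1)
  · -- Λ_UU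
    intro a ℓ ℓ' hℓ hℓ'
    by_cases hL : ℓ ∈ L
    · by_cases hL' : ℓ' ∈ L
      · by_cases hne : ℓ = ℓ'
        · subst hne
          exact (hB.Λ_diag a ℓ hL).trans ((hb24 a ℓ).trans hUUm)
        · refine (hB.Λ_on_on a ℓ hL ℓ' hL' hne).trans (max_le ?_ ?_)
          · exact (hb50 a ℓ ℓ').trans (h50.trans hUUm)
          · exact (hb54 a ℓ ℓ').trans ((le_of_eq (by ring)).trans hUUm)
      · have hU' : ℓ' ∈ U := by
          rcases hℓ' with h | h
          · exact h
          · exact absurd h hL'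
        calc S.Λ ν' a ℓ ℓ' ≤ S.b23 ν a ℓ ℓ' := hB.Λ_on_off a ℓ hL ℓ' hL'
          _ ≤ _ := hb23U a ℓ ℓ' hU'
          _ = (Δ : ℝ≥0∞) ^ (j + 1) * γ₀ + (cbar : ℝ≥0∞) * (Δ : ℝ≥0∞) ^ (j + 1 + 1) * Λ₀ := by
              ring
    · have hU : ℓ ∈ U := by
        rcases hℓ with h | h
        · exact h
        · exact absurd h hL
      by_cases hL' : ℓ' ∈ L
      · calc S.Λ ν' a ℓ ℓ' ≤ S.b22 ν a ℓ ℓ' := hB.Λ_off_on a ℓ hL ℓ' hL'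
          _ ≤ Γ + (cbar : ℝ≥0∞) * Θ := hb22 a ℓ ℓ'
          _ ≤ _ := hΓC
          _ ≤ _ := hUUm
      · have hU' : ℓ' ∈ U := by
          rcases hℓ' with h | h
          · exact h
          · exact absurd h hL'
        calc S.Λ ν' a ℓ ℓ' ≤ S.Λ ν a ℓ ℓ' := hB.Λ_off a ℓ ℓ' hL hL'
          _ ≤ (Δ : ℝ≥0∞) ^ j * γ₀ + (cbar : ℝ≥0∞) * (Δ : ℝ≥0∞) ^ (j + 1) * Λ₀ :=
              hT.Λ_UU a ℓ ℓ' hU hU'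
          _ ≤ (Δ : ℝ≥0∞) ^ (j + 1) * γ₀ + (cbar : ℝ≥0∞) * (Δ : ℝ≥0∞) ^ (j + 1 + 1) * Λ₀ := by
              gcongr
  · -- Λ_UW
    intro a ℓ ℓ' hℓ hℓ'
    simp only [Set.mem_union, Set.mem_setOf_eq, not_or] at hℓ'
    by_cases hL : ℓ ∈ L
    · calc S.Λ ν' a ℓ ℓ' ≤ S.b23 ν a ℓ ℓ' := hB.Λ_on_off a ℓ hL ℓ' hℓ'.2
        _ ≤ (Δ : ℝ≥0∞) * ((Δ : ℝ≥0∞) ^ j * Λ₀) := hb23W a ℓ ℓ' hℓ'.1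
        _ = (Δ : ℝ≥0∞) ^ (j + 1) * Λ₀ := by ring
    · have hU : ℓ ∈ U := by
        rcases hℓ with h | h
        · exact h
        · exact absurd h hL
      calc S.Λ ν' a ℓ ℓ' ≤ S.Λ ν a ℓ ℓ' := hB.Λ_off a ℓ ℓ' hL hℓ'.2
        _ ≤ (Δ : ℝ≥0∞) ^ j * Λ₀ := hT.Λ_UW a ℓ ℓ' hU hℓ'.1
        _ ≤ (Δ : ℝ≥0∞) ^ (j + 1) * Λ₀ := by gcongr
  · -- Λ_WU
    intro a ℓ ℓ' hℓ hℓ'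
    simp only [Set.mem_union, Set.mem_setOf_eq, not_or] at hℓ
    by_cases hL' : ℓ' ∈ L
    · calc S.Λ ν' a ℓ ℓ' ≤ S.b22 ν a ℓ ℓ' := hB.Λ_off_on a ℓ hℓ.2 ℓ' hL'
        _ ≤ γ₀ + (cbar : ℝ≥0∞) * ((j : ℝ≥0∞) * γ₀ + Λ₀) := hb22W a ℓ ℓ' hℓ.1
        _ = (1 + (cbar : ℝ≥0∞) * (j : ℝ≥0∞)) * γ₀ + (cbar : ℝ≥0∞) * Λ₀ := by ring
        _ ≤ ((j + 1 : ℕ) : ℝ≥0∞) * γ₀ + (cbar : ℝ≥0∞) * Λ₀ := by gcongr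
    · have hU' : ℓ' ∈ U := by
        rcases hℓ' with h | h
        · exact h
        · exact absurd h hL'
      calc S.Λ ν' a ℓ ℓ' ≤ S.Λ ν a ℓ ℓ' := hB.Λ_off a ℓ ℓ' hℓ.2 hL'
        _ ≤ (j : ℝ≥0∞) * γ₀ + (cbar : ℝ≥0∞) * Λ₀ := hT.Λ_WU a ℓ ℓ' hℓ.1 hU'
        _ ≤ ((j + 1 : ℕ) : ℝ≥0∞) * γ₀ + (cbar : ℝ≥0∞) * Λ₀ := by gcongr
  · -- Λ_WW
    intro a ℓ ℓ' hℓ hℓ'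
    simp only [Set.mem_union, Set.mem_setOf_eq, not_or] at hℓ hℓ'
    exact (hB.Λ_off a ℓ ℓ' hℓ.2 hℓ'.2).trans (hT.Λ_WW a ℓ ℓ' hℓ.1 hℓ'.1)

end Admissible

/-! ### §4 assembled: the sweep over all colour classes (Lemma 3.7) -/

section sweep

variable [Fintype ι] {χ : ℕ}

omit [Fintype A] in
/-- The `j`-th colour class `V_j` of a colouring `col : ι → Fin χ`, as a list (print (3), (30):
«Let `{ℓ₁, ℓ₂, …}` be any numbering of the elements of `V_j`»). [cite: ConacheEtAl2015, §2.1 (3), §4.1 (30)] -/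
def classList (col : ι → Fin χ) (j : Fin χ) : List ι := (univ.filter fun ℓ => col ℓ = j).toList

omit [Fintype A] in
/-- Membership in the `j`-th class. [cite: ConacheEtAl2015, §2.1 (3)] -/
theorem mem_classList {col : ι → Fin χ} {j : Fin χ} {ℓ : ι} :
    ℓ ∈ classList col j ↔ col ℓ = j := by
  simp [classList]

omit [Fintype A] in
/-- A class is enumerated without repetition. [cite: ConacheEtAl2015, §4.1 (30)] -/
theorem nodup_classList (col : ι → Fin χ) (j : Fin χ) : (classList col j).Nodup :=
  Finset.nodup_toList _

omit [Fintype A] in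
/-- A proper colouring makes every class independent in the sense of (2):
`∂ℓ ∩ V_j = ∅` for `ℓ ∈ V_j`. [cite: ConacheEtAl2015, §2.1 (2)–(3)] -/
theorem classList_independent {col : ι → Fin χ} (hcol : ∀ ℓ, ∀ ℓ' ∈ S.nbr ℓ, col ℓ' ≠ col ℓ)
    (j : Fin χ) : ∀ x ∈ classList col j, ∀ y ∈ S.nbr x, y ∉ classList col j := by
  intro x hx y hy hy'
  rw [mem_classList] at hx hy'
  exact hcol x y hy (hy'.trans hx.symm)

variable (S) in
/-- Reconstruction over the classes `V₀, …, V_{n−1}` in turn (print §4: `ν_n`, the measure after the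
reconstructions over `V₀, …, V_{n−1}`; `ν₀ = ν`). [cite: ConacheEtAl2015, §4 (29)–(30), §4.2] -/
def sweepUpTo (col : ι → Fin χ) (ν : St) : ℕ → St
  | 0 => ν
  | n + 1 => if h : n < χ then S.sweepList (classList col ⟨n, h⟩) (sweepUpTo col ν n)
      else sweepUpTo col ν n

variable (S) in
/-- **The measure `ν` of Lemma 3.7:** one full sweep `V₀, …, V_{χ−1}` of one-site reconstructions
applied to `ν₀`. [cite: ConacheEtAl2015, Lemma 3.7, §4] -/
def sweep (col : ι → Fin χ) (ν : St) : St := S.sweepUpTo col ν χ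

omit [Fintype A] in
/-- `ν_{n+1}` = reconstruction over `V_n` applied to `ν_n`. [cite: ConacheEtAl2015, §4.2] -/
theorem sweepUpTo_succ {col : ι → Fin χ} {ν : St} {n : ℕ} (hn : n < χ) :
    S.sweepUpTo col ν (n + 1) = S.sweepList (classList col ⟨n, hn⟩) (S.sweepUpTo col ν n) := by
  simp [sweepUpTo, hn]

omit [Fintype A] in
/-- Lemma 3.4 (a) along the whole sweep: a property preserved by each `R_ℓ` (being a coupling of
`μ₁, μ₂`) is preserved by `sweep`. [cite: ConacheEtAl2015, Lemma 3.4 (a), Lemma 3.7] -/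
theorem sweep_induction (P : St → Prop) (hP : ∀ ℓ ν, P ν → P (S.R ℓ ν)) (col : ι → Fin χ)
    {ν : St} (hν : P ν) : P (S.sweep col ν) := by
  suffices h : ∀ n, P (S.sweepUpTo col ν n) from h χ
  intro n
  induction n with
  | zero => exact hν
  | succ n ih =>
    by_cases hn : n < χ
    · rw [sweepUpTo_succ hn]; exact S.sweepList_induction P hP _ _ ih
    · simp only [sweepUpTo, hn, dite_false]; exact ih

/-- The invariant of §4.2: after the classes `V₀, …, V_{n−1}` the table (41)–(42) holds at level `n`
for `U_{n−1} = V₀ ∪ ⋯ ∪ V_{n−1}`. [cite: ConacheEtAl2015, §4.2 (41)–(42)] -/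
theorem table_sweepUpTo (h : S.IsDPStep) {Δ : ℕ} {κbar cbar α : ℝ≥0}
    (hA : S.Admissible Δ χ κbar cbar α) {col : ι → Fin χ}
    (hcol : ∀ ℓ, ∀ ℓ' ∈ S.nbr ℓ, col ℓ' ≠ col ℓ) {γ₀ Λ₀ : ℝ≥0∞} {ν : St}
    (hγ : ∀ ℓ, S.γf ν ℓ ≤ γ₀) (hΛ : ∀ a ℓ ℓ', S.Λ ν a ℓ ℓ' ≤ Λ₀) :
    ∀ n, n ≤ χ → S.Table Δ κbar cbar α γ₀ Λ₀ {ℓ | (col ℓ : ℕ) < n} n (S.sweepUpTo col ν n) := by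
  intro n
  induction n with
  | zero =>
    intro _
    have hU : {ℓ : ι | ((col ℓ : Fin χ) : ℕ) < 0} = ∅ := by ext; simp
    rw [hU]
    exact table_empty hγ hΛ
  | succ n ih =>
    intro hn
    have hn' : n < χ := by omega
    have hT := ih hn'.le
    rw [sweepUpTo_succ hn']
    have hB := h.classBounds (classList col ⟨n, hn'⟩) (nodup_classList col _)
      (classList_independent hcol _) (S.sweepUpTo col ν n)
    have hU : {ℓ : ι | ((col ℓ : Fin χ) : ℕ) < n + 1} =
        {ℓ : ι | ((col ℓ : Fin χ) : ℕ) < n} ∪ {x | x ∈ classList col ⟨n, hn'⟩} := by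
      ext ℓ
      simp only [Set.mem_setOf_eq, Set.mem_union, mem_classList, Fin.ext_iff]
      omega
    rw [hU]
    rcases Nat.eq_zero_or_pos n with hn0 | hn0
    · subst hn0
      have hU0 : {ℓ : ι | ((col ℓ : Fin χ) : ℕ) < 0} = ∅ := by ext; simp
      rw [hU0, Set.empty_union]
      have hT0 : S.Table Δ κbar cbar α γ₀ Λ₀ ∅ 0 (S.sweepUpTo col ν 0) := table_empty hγ hΛ
      exact hA.table_base (by omega) (fun ℓ => hT0.γ_W ℓ (by simp))
        (fun a ℓ ℓ' => hT0.Λ_WW a ℓ ℓ' (by simp) (by simp)) hB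
    · exact hA.table_step hn0 (by omega) hT hB

/-- **Lemma 3.7 (one sweep), abstract form.** Under the one-step estimates (21)–(24) and the
standing hypotheses on the constants, for every `ν₀` with `γ(ν₀) ≤ γ₀`, `λ(ν₀) ≤ Λ₀`, the measure
`ν = sweep ν₀` satisfies
(27) `γ(ν) ≤ [κ̄ + AK⁻¹] γ₀ + 2AK⁻¹ Λ₀` (verbatim, `α = AK⁻¹`) and
(28′) `λ(ν) ≤ Δ^χ γ₀ + c̄ Δ^{χ+1} Λ₀`.
PRINT states (28) with `Δ^{χ−1}`, `c̄Δ^χ`; the induction (41)–(42) of §4.2 is at level `j` after `j`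
classes («Since `W_{Δ−1} = ∅` … for `j = Δ − 1` we have just the first lines in (41) and (42), which
yields (27) and (28)»), and after all `χ` classes the level is `χ`, which is what is proved here — one
power of `Δ` weaker than (28) as printed (recorded as erratum candidate E-DP-1 in the pub-ymgap
records; the abstract hypotheses (21)–(24) do not give more: see the module docstring).
[cite: ConacheEtAl2015, Lemma 3.7 (27)–(28), §4.2] -/
theorem lemma_3_7 (h : S.IsDPStep) {Δ : ℕ} {κbar cbar α : ℝ≥0}
    (hA : S.Admissible Δ χ κbar cbar α) {col : ι → Fin χ}
    (hcol : ∀ ℓ, ∀ ℓ' ∈ S.nbr ℓ, col ℓ' ≠ col ℓ) {γ₀ Λ₀ : ℝ≥0∞} {ν : St}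
    (hγ : ∀ ℓ, S.γf ν ℓ ≤ γ₀) (hΛ : ∀ a ℓ ℓ', S.Λ ν a ℓ ℓ' ≤ Λ₀) :
    (∀ ℓ, S.γf (S.sweep col ν) ℓ ≤ ((κbar : ℝ≥0∞) + α) * γ₀ + 2 * (α : ℝ≥0∞) * Λ₀) ∧
      ∀ a ℓ ℓ', S.Λ (S.sweep col ν) a ℓ ℓ' ≤
        (Δ : ℝ≥0∞) ^ χ * γ₀ + (cbar : ℝ≥0∞) * (Δ : ℝ≥0∞) ^ (χ + 1) * Λ₀ := by
  have hT := S.table_sweepUpTo h hA hcol hγ hΛ χ le_rfl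
  have hU : ∀ ℓ, ℓ ∈ {ℓ : ι | ((col ℓ : Fin χ) : ℕ) < χ} := fun ℓ => (col ℓ).isLt
  exact ⟨fun ℓ => hT.γ_U ℓ (hU ℓ), fun a ℓ ℓ' => hT.Λ_UU a ℓ ℓ' (hU ℓ) (hU ℓ')⟩

/-- **(28a): the recursion for repeated sweeps.** With `ν̂ₙ = sweepⁿ ν₀`,
`γₙ := sup_ℓ ν̂ₙ(I_ℓ)`, `λₙ := sup_{i,ℓ,ℓ'} ν̂ₙ(I_ℓ H^i_{ℓ'})`:
`γₙ₊₁ ≤ [κ̄ + AK⁻¹] γₙ + 2AK⁻¹ λₙ` and `λₙ₊₁ ≤ Δ^χ γₙ + c̄Δ^{χ+1} λₙ` — the input of the `2 × 2`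
contraction (`Literature/Probability/TransportMaps/DobrushinPecherskyContraction.lean`:
`max_iterate_le`, `fst_iterate_le`). [cite: ConacheEtAl2015, §3.3 (28a)] -/
theorem iterate_recursion (h : S.IsDPStep) {Δ : ℕ} {κbar cbar α : ℝ≥0}
    (hA : S.Admissible Δ χ κbar cbar α) {col : ι → Fin χ}
    (hcol : ∀ ℓ, ∀ ℓ' ∈ S.nbr ℓ, col ℓ' ≠ col ℓ) (ν : St) (n : ℕ) :
    (⨆ ℓ, S.γf ((S.sweep col)^[n + 1] ν) ℓ) ≤
        ((κbar : ℝ≥0∞) + α) * (⨆ ℓ, S.γf ((S.sweep col)^[n] ν) ℓ) +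
          2 * (α : ℝ≥0∞) * (⨆ p : A × ι × ι, S.Λ ((S.sweep col)^[n] ν) p.1 p.2.1 p.2.2) ∧
      (⨆ p : A × ι × ι, S.Λ ((S.sweep col)^[n + 1] ν) p.1 p.2.1 p.2.2) ≤
        (Δ : ℝ≥0∞) ^ χ * (⨆ ℓ, S.γf ((S.sweep col)^[n] ν) ℓ) +
          (cbar : ℝ≥0∞) * (Δ : ℝ≥0∞) ^ (χ + 1) *
            (⨆ p : A × ι × ι, S.Λ ((S.sweep col)^[n] ν) p.1 p.2.1 p.2.2) := by
  rw [Function.iterate_succ_apply']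
  set ν' := (S.sweep col)^[n] ν
  have hγ : ∀ ℓ, S.γf ν' ℓ ≤ ⨆ ℓ, S.γf ν' ℓ := fun ℓ => le_iSup (fun ℓ => S.γf ν' ℓ) ℓ
  have hΛ : ∀ a ℓ ℓ', S.Λ ν' a ℓ ℓ' ≤ ⨆ p : A × ι × ι, S.Λ ν' p.1 p.2.1 p.2.2 :=
    fun a ℓ ℓ' => le_iSup (fun p : A × ι × ι => S.Λ ν' p.1 p.2.1 p.2.2) (a, ℓ, ℓ')
  obtain ⟨h1, h2⟩ := S.lemma_3_7 h hA hcol hγ hΛ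
  exact ⟨iSup_le h1, iSup_le fun p => h2 p.1 p.2.1 p.2.2⟩

end sweep

end DPSystem

end DobrushinPecherskySweep

end Literature.Probability.TransportMaps
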